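import Literature.MathematicalPhysics.QuantumFieldTheory.Balaban1983to89.B6Prop22DerivMultiLevelBoxL0
import Literature.MathematicalPhysics.QuantumFieldTheory.Balaban1983to89.B6Prop22HolderTwoLevelBox
import Literature.MathematicalPhysics.QuantumFieldTheory.Balaban1983to89.B6HolderTermMultiLevelBox
import Literature.MathematicalPhysics.QuantumFieldTheory.Balaban1983to89.B6Ineq243HolderTwoLevelBoxL0

/-!
# `Balaban1983to89.B6HolderTermMultiLevelBoxL0` — LEVEL-0 TWIN (programme G-F3′-L0, director-ym LINE №27 / UV3-NODE §24.5; plan `lit-balaban-r03/G-F3L0-PLAN.md`) of `B6HolderTermMultiLevelBox`: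
the same declarations, SAME NAMES AND STATEMENTS, for nested families WITH print's region `Λ₀ = T ∖ Ω₁` ADMITTED (structures
`B6MultiLevelBoxOperatorL0.Domains` / `B6MultiLevelTorusOperatorL0.TDomains`: levels `0, …, k`, the level-`0` block a single site, `Q′₀ = id`,
finite weight `a₀` — print p.225 (2.14) «Σ_{j=0}^k … (Q′₀λ)(x) = λ(x), x ∈ Λ₀», p.229 «taking a sequence (2.1) … smallest possible domains B^j(Λ_j),
and considering the operator Δ_a defined by (2.19), (2.20) for this sequence»).  Every `D`-free object is the lineage's, consumed BY NAME; no existing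
module is touched; no fact is minted.  Unit `lit-balaban-p21` (packet S-B owner, p21 gen 26; port tooling by r03 gen 36); B6 fold owner r03; referee ref-4.  THE TWIN'S DOCUMENTATION FOLLOWS
VERBATIM (its «levels 1 … k» / «Ω₁ = X» sentences describe the twin; here `j` runs from `0` and `Ω₁` may be a proper subset).

# `Balaban1983to89.B6HolderTermMultiLevelBox` — [B6] PROPOSITION 2.2, FOURTH ENTRY OF (2.67) (`‖ζ∇^η_xG′λ‖_α`),
GENUINE `k`-LEVEL OPERATOR ON A BOX, PART 1: THE HÖLDER-WEIGHTED MIXED DIFFERENCE OF ONE TERM `h_□G′(□)v_□λ` OF `G′₀`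
(file 10 of the multi-level parametrix: the per-term (2.64)-input of the Hölder entry; no existing module is touched;
no fact is minted)

FRAMING (verbatim cell line):
statement-level skeleton of published theorems with citation tags; proofs where landed; nothing here is a claim about the Yang–Mills mass gap

Source under audit (cell pub-balaban / lit-balaban): T. Bałaban, *Propagators and renormalization transformations for
lattice gauge theories. II*, Commun. Math. Phys. **96** (1984) 223–250 [`Balaban1984PropagatorsII`, "B6"], p. 234
[PDF 12] (2.64)–(2.67), Proposition 2.2; p. 229–230 [PDF 7–8] (2.36)–(2.38), (2.42)–(2.43) (renders
`run/shared/lean/pub/pub-balaban/b2b-balaban-ref1/pages/1984-cmp96-propagators-rt-II/…-p007/p008/p012-x2.png`); [3] =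
T. Bałaban, *Regularity and decay of lattice Green's functions*, Commun. Math. Phys. **89** (1983) 571–597
[`Balaban1983RegularityDecay`, "B4"], Theorem (1.9) p. 573, §2 pp. 575–577 ((2.6), «|∂^ηh_j| ≤ O(M⁻¹)»,
«|Δ^ηh_j| ≤ O(M⁻²)»).  Unit `lit-balaban-p21` (Phase-2 proof seat p21 gen 11), HOME `run/shared/lean/pub/lit-balaban/`,
B6 fold owner r03, referee ref-4.

## WHAT IS PRINTED (p. 234, verbatim up to notation)

«… |(G′λ)(x)| ≤ Σ_{n=0}^∞ |(G′₀Rⁿλ)(x)| ≤ O(1)(L^jη)² e^{−½δ₀d(y,y′)}|λ|. (2.66)  The similar inequalities hold for a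
derivative of G′λ and for a Hölder norm of a derivative, but with (L^jη)² replaced by L^jη and (L^jη)^{1−α}
correspondingly. Let us formulate these results in Proposition 2.2. If we have (2.1), (2.2) and M is sufficiently
large, then the operator G′ = Δ′_a^{−1}(a = 1) satisfies the inequalities |(G′λ)(x)|, |(∇^η_xG′λ)(x)|,
|(G′∇^{η*}λ)(x)|, ‖ζ∇^η_xG′λ‖_α, ‖ζG′∇^{η*}λ‖_α, |(Δ^ηG′λ)(x)| ≤ O(1)[(L^jη)², L^jη, L^jη, (L^jη)^{1−α}(‖ζ‖_α + |ζ|),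
(L^jη)^{1−α}(‖ζ‖_α + |ζ|), 1]·e^{−½δ₀d(y,y′)}|λ|, x ∈ B^j(y) or supp ζ ⊂ B^j(y), y ∈ Λ_j, supp λ ⊂ B^{j′}(y′),
y′ ∈ Λ_{j′}. (2.67)»; p. 230: «Properties of the operators G′_j(□), G′_j(□)Q′_j* and C_Λ^{(j)}(□) are described in
Lemmas 2.2, 2.4, Proposition 2.3 [3]. From these and (2.42) we get» (2.43) — the cube estimates come from [3], whose
Theorem (1.9) (p. 573) is the Hölder estimate `|x−x′|^{−α}|(∇G(x,y) − ∇G(x′,y))| ≤ …` «without any restrictions on the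
points x, x′» (docfix: the sentence of p. 230 quoted verbatim, referee NOTE S-B6-g41-2; no declaration changed).

## WHAT THIS FILE CERTIFIES (kernel-checked; setting of files 1–6 of the multi-level parametrix)

For the genuine `k`-level operator of a nested family `D : Domains d ℓ M_h k P R` on the box (file 1), the multi-size
cover `𝒟` with its terms `h_□G′(□)v_□` (`aX`, file 2: every `G′(□)` a genuine two-level cube propagator at the cube's
finer level `i_□`), the blocks `𝔅`/`blkOf`/distance `d` of `geom D` (file 4), in lattice units:
* §2 geometry: the [3] (2.6) margin at two unit lengths for the multi-size cover (`img_of_near`: a box site within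
  `2L^{i_□}` fine sites of a site carrying `h_□` lies in the cube image, `M_h ≥ 3`), and the diameter of a block
  (`supNorm_le_of_blkOf_eq`: two sites of `B^j(y)` are `≤ L^j − 1` apart);
* §3 `aX_diff_le` — ONE TERM OF `∇G′₀` AT ONE BOND (the per-term bound inside file 6's `dMat_gZeroML_majorant`,
  exported): `|(h_□G′(□)v_□λ)(x+e_μ) − (h_□G′(□)v_□λ)(x)| ≤ L^{j}·Q·e^{−δ₃d(y,y′)/(d+1)}·|λ|`, `x ∈ B^j(y)`,
  `supp λ ⊂ B^{j′}(y′)`;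
* §4 `aX_dd_near_le` — NEAR PAIRS (`|x′−x|_∞ + 1 ≤ 2L^{i_□}`, one of the four points carrying `h_□`), deterministic
  form given the three cube-level inputs (rows, differenced rows, Hölder-weighted doubly differenced rows of `G′(□)`):
  the four points lie in the cube (§2); the FOUR-TERM PRODUCT RULE for
  `dd(h_□·G) = ddh_□·G(x′+e_μ) + (h_□(x′)−h_□(x))·∂G(x′) + ∂h_□(x)·(G(x′+e_μ) − G(x+e_μ)) + h_□(x)·ddG`
  (`G = L^{2i_□}G′(□)v_□λ`): `|ddh_□| ≤ (D₂ + dD₁²)|x′−x|/(L^{j_□}M)²` (`B6Prop22HolderTwoLevelBox.abs_hq_dd_le`) times a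
  row ((2.43)₁), `|h_□(x′)−h_□(x)| ≤ (d+1)D₁|x′−x|/(L^{j_□}M)` times a differenced row ((2.43)₂), `|∂h_□| ≤ (d+1)D₁/(L^{j_□}M)`
  times a long difference (telescoped differenced rows, `B6Prop22HolderTwoLevelBox.wsum_longDiff_le`), `|h_□| ≤ 1` times the
  cube Hölder clause; the weights `|x′−x|^{−α}|x′−x| ≤ (L^j)^{1−α}` (one block), `L^{i_□} ≤ L^{j}` (the level window of
  file 2), `|x′−x|^{−α}L^{2i_□} = (L^{i_□})^{1−α}·(L^{i_□}/|x′−x|)^α·L^{i_□}`;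
* §5 `aX_dd_le` — EVERY PAIR `x ≠ x′` OF ONE BLOCK with `x+e_μ, x′+e_μ` in the box: there are `δ₄, Q > 0` with
  `|x′−x|_∞^{−α}·|((h_□G′(□)v_□λ)(x′+e_μ) − (…)(x′)) − ((…)(x+e_μ) − (…)(x))| ≤ (L^{j})^{1−α}·Q·e^{−δ₄d(y,y′)/(d+1)}·|λ|`
  — near pairs by §4 fed with `B6Ineq243TwoLevelBoxL0.ineq243_twoLevel_roww/_deriv_wsum` and
  `B6Ineq243HolderTwoLevelBox.ineq243_twoLevel_holder_wsum2` on the cube, far pairs (`|x′−x|_∞ ≥ L^{i_□}`) by §3 twice and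
  `|x′−x|^{−α}L^{j} ≤ L·(L^{j})^{1−α}`.
The sum over the cover, the lifted fixed point and the chain (2.64)–(2.66) are file 11 `B6Prop22HolderMultiLevelBox`.

## HONEST SCOPE

As files 1–6: levels `1 … k` on a Neumann box, `m² = 0`, the asymmetric partition (`u_□ = h_□`, `v_□ = h_□1_{B^j(Λ_j)}`),
`M_h ≥ 3`, `R ≥ 2L`; lattice units (`G′` here is `η^{−2}G′` of print, the differences are `η∇^η`, the Hölder weight is
`|x′−x|_∞^{−α}` in fine sites — whence `(L^{j})^{1−α}` for «(L^jη)^{1−α}»); the Hölder pairs are the pairs `x ≠ x′`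
of ONE block `B^j(y)` of `𝔅` (print: «supp ζ ⊂ B^j(y)»), the cut-off `ζ` and the factor `(‖ζ‖_α + |ζ|)` being dispensed
with as in [3] (1.9); `0 ≤ α < 1`, with the rate as well as the constants depending on `α` (the cube Hölder clause of
the lineage is «∀α ∃δ»); constants existential (functions of `d`, `ℓ`, `α`, the windows).  Nothing is inferred from the
manuscript: every step is kernel-checked.
-/

namespace Literature.MathematicalPhysics.QuantumFieldTheory.Balaban1983to89.B6HolderTermMultiLevelBoxL0

open Finset Matrix
open Literature.MathematicalPhysics.QuantumFieldTheory.Balaban1983to89.B4ContourShift (supNorm supNorm_nonneg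
  abs_le_supNorm exists_supNorm_eq)
open Literature.MathematicalPhysics.QuantumFieldTheory.Balaban1983to89.B4Reflection242 (boxDom mem_boxDom blk nbrs
  mem_nbrs)
open Literature.MathematicalPhysics.QuantumFieldTheory.Balaban1983to89.B4Lemma22ReduceZero (Box)
open Literature.MathematicalPhysics.QuantumFieldTheory.Balaban1983to89.B4PartitionUnity22 (hprof D1 D2 D1_nonneg D2_nonneg
  contDiff_hprof hasCompactSupport_hprof)
open Literature.MathematicalPhysics.QuantumFieldTheory.Balaban1983to89.B4Thm110ZeroBox (boxCast boxCast_apply_val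
  boxCast_symm_apply_val mem_boxDom_of_eq roww mulVec_le_of_roww supNorm_sub_le_sub_add_sub)
open Literature.MathematicalPhysics.QuantumFieldTheory.Balaban1983to89.B4Thm110ZeroBoxDeriv (wsum supNorm_single_le
  supNorm_sub_le_nbr)
open Literature.MathematicalPhysics.QuantumFieldTheory.Balaban1983to89.B6Ineq243TwoLevelBox hiding ineq243_twoLevel_deriv_value ineq243_twoLevel_deriv_wsum ineq243_twoLevel_dist ineq243_twoLevel_rowSum_colSum ineq243_twoLevel_roww ineq243_twoLevel_value ineq244_twoLevel
open Literature.MathematicalPhysics.QuantumFieldTheory.Balaban1983to89.B6Ineq243TwoLevelBoxL0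
open Literature.MathematicalPhysics.QuantumFieldTheory.Balaban1983to89.B6Partition236TwoLevelBox
open Literature.MathematicalPhysics.QuantumFieldTheory.Balaban1983to89.B6Eq238TwoLevelBox
open Literature.MathematicalPhysics.QuantumFieldTheory.Balaban1983to89.B6Ineq249TwoLevelBox (near card_near_le
  mem_near_of_abs_lt emb_sub_emb)
open Literature.MathematicalPhysics.QuantumFieldTheory.Balaban1983to89.B6MultiLevelBoxOperator hiding Domains mlOp_apply
open Literature.MathematicalPhysics.QuantumFieldTheory.Balaban1983to89.B6MultiLevelBoxOperatorL0
open Literature.MathematicalPhysics.QuantumFieldTheory.Balaban1983to89.B6Eq238MultiLevelBox hiding Active CubeData Down Ep LamG aX bX cG cOp cOp_mul_cG ctrs_Pj_subset cubeData_of_mem cubeSet diagonal_mul_eq_pad eq238_multiLevelBox fin fin_data fin_spec gX gZeroML isBlockUnion_LamG lev_corner_ublk mem_LamG mem_cubeSet mlOp_emb_emb mlOp_emb_off mlOp_mul_aX mlOp_mul_term rML row_eq_pad_row sum_uv_eq_one vFun vX window_of_active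
open Literature.MathematicalPhysics.QuantumFieldTheory.Balaban1983to89.B6Eq238MultiLevelBoxL0
open Literature.MathematicalPhysics.QuantumFieldTheory.Balaban1983to89.B6Ineq249MultiLevelBox hiding abs_vFun_le_one bX_eq bX_mulVec_apply embC eq250_multiLevelBox innerB local_comm_bound mem_keySet_of_bX_ne_zero norm_rML_le
open Literature.MathematicalPhysics.QuantumFieldTheory.Balaban1983to89.B6Ineq249MultiLevelBoxL0
open Literature.MathematicalPhysics.QuantumFieldTheory.Balaban1983to89.B6Geom246MultiLevelBox hiding Touch blkOf blkOf_corner blkOf_eq_iff_blk blkOf_eq_of_blk_i_eq blkOf_val bond bond_adj bset cen connected coord_bounds corner corner_mem csys dist_blkOf_le_box dist_blkOf_le_coord dist_blkOf_le_line dist_cen_le_of_adj dist_cen_le_of_touch dist_le_one_of_near dist_toR_cen_le exists_blkOf_eq geom lemma21_box lev_corner lev_eq_of_blkOf_eq levelGap pack reachable_blkOf reachable_of_near realizes scale_bounds touch_symm triangle_refl_nonneg walk_disp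
open Literature.MathematicalPhysics.QuantumFieldTheory.Balaban1983to89.B6Geom246MultiLevelBoxL0
open Literature.MathematicalPhysics.QuantumFieldTheory.Balaban1983to89.B6Prop22MultiLevelBox hiding Dd_le_supNorm aX_mulVec_apply bX_row_img bX_row_off dist_blkOf_le_in_cube fixedPoint_gml gX_row_img gX_row_off gZeroML_majorant lev_window_of_inCube mem_keySet_of_aX_ne_zero prop22_first_multiLevelBox rML_majorant
open Literature.MathematicalPhysics.QuantumFieldTheory.Balaban1983to89.B6Prop22MultiLevelBoxL0
open Literature.MathematicalPhysics.QuantumFieldTheory.Balaban1983to89.B6Prop22DerivMultiLevelBox (dMat dMat_mulVec_of_mem)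
open Literature.MathematicalPhysics.QuantumFieldTheory.Balaban1983to89.B6Prop22DerivMultiLevelBoxL0 (img_of_uX_ne_zero mem_keySet_of_uX_ne_zero)
open Literature.MathematicalPhysics.QuantumFieldTheory.Balaban1983to89.B6Prop22HolderTwoLevelBox (abs_hq_dd_le
  wsum_longDiff_le)
open Literature.MathematicalPhysics.QuantumFieldTheory.Balaban1983to89.B6Ineq243HolderTwoLevelBoxL0
  (ineq243_twoLevel_holder_wsum2)
open Literature.MathematicalPhysics.QuantumFieldTheory.Balaban1983to89.B6RandomWalk (HasMajorant BlockSupp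
  hasMajorant_mono)
open Literature.MathematicalPhysics.QuantumFieldTheory.Balaban1983to89.B6Ineq261LevelGap (K261 K261_nonneg
  theta_lt_one_of_log)
open Literature.MathematicalPhysics.QuantumFieldTheory.Balaban1983to89.B6Prop23Chain (majorant_of_fixedPoint_266W)

noncomputable section

variable {d : ℕ}

/-! ## §1 Tools -/

section Tools

/-- a sum over a finite type whose non-zero terms are indexed injectively into a finset `T` and are bounded by
`B ≥ 0` is at most `|T|·B`. [folklore] -/
private theorem sum_le_card_mul {ι σ : Type*} [Fintype ι] [DecidableEq σ] (f : ι → ℝ) (key : ι → σ)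
    (hkey : Function.Injective key) (T : Finset σ) (hT : ∀ i, f i ≠ 0 → key i ∈ T) {B : ℝ} (hB : 0 ≤ B)
    (hf : ∀ i, f i ≤ B) : ∑ i, f i ≤ T.card * B := by
  classical
  rw [← Finset.sum_filter_ne_zero]
  have hcard : (Finset.univ.filter fun i => f i ≠ 0).card ≤ T.card :=
    Finset.card_le_card_of_injOn key (fun i hi => by
      rw [Finset.coe_filter] at hi; exact hT i hi.2) (fun i _ j _ h => hkey h)
  calc ∑ i ∈ Finset.univ.filter (fun i => f i ≠ 0), f i
      ≤ (Finset.univ.filter fun i => f i ≠ 0).card • B := Finset.sum_le_card_nsmul _ _ _ fun i _ => hf i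
    _ = ((Finset.univ.filter fun i => f i ≠ 0).card : ℝ) * B := by rw [nsmul_eq_mul]
    _ ≤ T.card * B := mul_le_mul_of_nonneg_right (by exact_mod_cast hcard) hB

/-- a weighted `ℓ¹` row bound gives decay against bounded vectors supported at (one- or two-centre) distance `≥ D`.
[folklore] -/
private theorem sum_mul_le_of_wrow {X : Type*} [Fintype X] {δ n c F Dd : ℝ} (hn : 0 < n) (hF0 : 0 ≤ F)
    (r u : X → ℝ) (dist : X → ℝ) (hrow : ∑ z, |r z| * Real.exp (δ * dist z / n) ≤ c)
    (hF : ∀ z, |u z| ≤ F) (hD : ∀ z, u z ≠ 0 → Dd ≤ dist z) (hδ : 0 ≤ δ) :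
    |∑ z, r z * u z| ≤ c * Real.exp (-(δ * Dd / n)) * F := by
  have hterm : ∀ z, |r z * u z| ≤ |r z| * Real.exp (δ * dist z / n) * (Real.exp (-(δ * Dd / n)) * F) := by
    intro z
    by_cases hz : u z = 0
    · rw [hz, mul_zero, abs_zero]; positivity
    rw [abs_mul]
    have h1 : 1 ≤ Real.exp (δ * dist z / n) * Real.exp (-(δ * Dd / n)) := by
      rw [← Real.exp_add]
      refine Real.one_le_exp ?_
      have := div_le_div_of_nonneg_right (mul_le_mul_of_nonneg_left (hD z hz) hδ) hn.le
      linarith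
    calc |r z| * |u z| ≤ |r z| * (1 * F) := by
          rw [one_mul]; exact mul_le_mul_of_nonneg_left (hF z) (abs_nonneg _)
      _ ≤ |r z| * (Real.exp (δ * dist z / n) * Real.exp (-(δ * Dd / n)) * F) :=
          mul_le_mul_of_nonneg_left (mul_le_mul_of_nonneg_right h1 hF0) (abs_nonneg _)
      _ = |r z| * Real.exp (δ * dist z / n) * (Real.exp (-(δ * Dd / n)) * F) := by ring
  calc |∑ z, r z * u z| ≤ ∑ z, |r z * u z| := Finset.abs_sum_le_sum_abs _ _
    _ ≤ ∑ z, |r z| * Real.exp (δ * dist z / n) * (Real.exp (-(δ * Dd / n)) * F) :=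
        Finset.sum_le_sum fun z _ => hterm z
    _ = (∑ z, |r z| * Real.exp (δ * dist z / n)) * (Real.exp (-(δ * Dd / n)) * F) := by rw [Finset.sum_mul]
    _ ≤ c * (Real.exp (-(δ * Dd / n)) * F) := mul_le_mul_of_nonneg_right hrow (by positivity)
    _ = c * Real.exp (-(δ * Dd / n)) * F := by ring

/-- the exponent bookkeeping: `e^{−δD/L^i} = e^{δ}·e^{−(δ/(d+1))·dist}` for `D = L^i(dist/(d+1) − 1)`. [folklore] -/
private theorem exp_Dd_eq {δ n dist : ℝ} (hn : 0 < n) (d : ℕ) :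
    Real.exp (-(δ * (n * (dist / (d + 1) - 1)) / n)) = Real.exp δ * Real.exp (-(δ / (d + 1) * dist)) := by
  rw [← Real.exp_add]
  congr 1
  field_simp
  ring

/-- the shift by one lattice step: `e^{−δ(D−1)/n} ≤ e^{δ}·e^{−δD/n}` for `n ≥ 1`, `δ ≥ 0`. [folklore] -/
private theorem exp_shift_le {δ n Dd : ℝ} (hδ : 0 ≤ δ) (hn : 1 ≤ n) :
    Real.exp (-(δ * (Dd - 1) / n)) ≤ Real.exp δ * Real.exp (-(δ * Dd / n)) := by
  rw [← Real.exp_add, Real.exp_le_exp]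
  have hn0 : 0 < n := by linarith
  have h1 : -(δ * (Dd - 1) / n) = -(δ * Dd / n) + δ / n := by
    field_simp
    ring
  rw [h1]
  have : δ / n ≤ δ := div_le_self hδ hn
  linarith

/-- the weakening of a rate against a non-negative distance. [folklore] -/
private theorem exp_rate_mono {δ δ' dist : ℝ} (hδ : δ' ≤ δ) (hdist : 0 ≤ dist) (d : ℕ) :
    Real.exp (-(δ / (d + 1) * dist)) ≤ Real.exp (-(δ' / (d + 1) * dist)) := by
  rw [Real.exp_le_exp, neg_le_neg_iff]
  exact mul_le_mul_of_nonneg_right (div_le_div_of_nonneg_right hδ (by positivity)) hdist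

/-- the three exponent steps at once: `e^{−δ(D−1)/n} ≤ e^{2δ}·e^{−(δ′/(d+1))dist}` for `D = n(dist/(d+1) − 1)`,
`δ′ ≤ δ`, `n ≥ 1`. [folklore] -/
private theorem exp_shift_Dd_le {δ δ' n dist : ℝ} (hδ : 0 ≤ δ) (hδ' : δ' ≤ δ) (hn : 1 ≤ n) (hdist : 0 ≤ dist) (d : ℕ) :
    Real.exp (-(δ * (n * (dist / (d + 1) - 1) - 1) / n))
      ≤ Real.exp δ * Real.exp δ * Real.exp (-(δ' / (d + 1) * dist)) := by
  have hn0 : 0 < n := by linarith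
  refine (exp_shift_le hδ hn).trans ?_
  rw [exp_Dd_eq hn0 d, mul_assoc]
  exact mul_le_mul_of_nonneg_left (mul_le_mul_of_nonneg_left (exp_rate_mono hδ' hdist d) (Real.exp_pos _).le)
    (Real.exp_pos _).le

/-- the two exponent steps: `e^{−δD/n} ≤ e^{2δ}·e^{−(δ′/(d+1))dist}`. [folklore] -/
private theorem exp_Dd_le {δ δ' n dist : ℝ} (hδ : 0 ≤ δ) (hδ' : δ' ≤ δ) (hn : 1 ≤ n) (hdist : 0 ≤ dist) (d : ℕ) :
    Real.exp (-(δ * (n * (dist / (d + 1) - 1)) / n))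
      ≤ Real.exp δ * Real.exp δ * Real.exp (-(δ' / (d + 1) * dist)) := by
  have hn0 : 0 < n := by linarith
  rw [exp_Dd_eq hn0 d, mul_assoc]
  have h1 : (1 : ℝ) ≤ Real.exp δ := Real.one_le_exp hδ
  calc Real.exp δ * Real.exp (-(δ / (d + 1) * dist))
      ≤ Real.exp δ * Real.exp (-(δ' / (d + 1) * dist)) :=
        mul_le_mul_of_nonneg_left (exp_rate_mono hδ' hdist d) (Real.exp_pos _).le
    _ = 1 * (Real.exp δ * Real.exp (-(δ' / (d + 1) * dist))) := (one_mul _).symm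
    _ ≤ Real.exp δ * (Real.exp δ * Real.exp (-(δ' / (d + 1) * dist))) :=
        mul_le_mul_of_nonneg_right h1 (by positivity)

/-- THE FOUR-TERM PRODUCT RULE for a weighted mixed second difference of a product `u·G` over the quadruple
`x, x+e, x′, x′+e` (indices 1, 2, 3, 4): `dd(uG) = ddu·G₄ + (u₃−u₁)(G₄−G₃) + (u₂−u₁)(G₄−G₂) + u₁·ddG`. [folklore] -/
private theorem four_term_abs_le {W u₁ u₂ u₃ u₄ G₁ G₂ G₃ G₄ B₁ B₂ B₃ B₄ : ℝ}
    (h1 : |W * ((u₄ - u₃) - (u₂ - u₁)) * G₄| ≤ B₁) (h2 : |W * (u₃ - u₁) * (G₄ - G₃)| ≤ B₂)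
    (h3 : |(u₂ - u₁) * (W * (G₄ - G₂))| ≤ B₃) (h4 : |u₁ * (W * ((G₄ - G₃) - (G₂ - G₁)))| ≤ B₄) :
    |W * ((u₄ * G₄ - u₃ * G₃) - (u₂ * G₂ - u₁ * G₁))| ≤ B₁ + B₂ + B₃ + B₄ := by
  have e : W * ((u₄ * G₄ - u₃ * G₃) - (u₂ * G₂ - u₁ * G₁))
      = W * ((u₄ - u₃) - (u₂ - u₁)) * G₄ + W * (u₃ - u₁) * (G₄ - G₃) + (u₂ - u₁) * (W * (G₄ - G₂))
        + u₁ * (W * ((G₄ - G₃) - (G₂ - G₁))) := by ring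
  rw [e]
  refine (abs_add_le _ _).trans (add_le_add ((abs_add_le _ _).trans (add_le_add ((abs_add_le _ _).trans
    (add_le_add h1 h2)) h3)) h4)

/-- Hölder weights: `s^{−α}·s = s^{1−α} ≤ T^{1−α}` for `0 < s ≤ T`, `α ≤ 1`. [folklore] -/
private theorem rpow_neg_mul_self_le {s T α : ℝ} (hs : 0 < s) (hsT : s ≤ T) (hα : α ≤ 1) :
    s ^ (-α) * s ≤ T ^ (1 - α) := by
  have e : s ^ (-α) * s = s ^ (1 - α) := by
    rw [show (1 : ℝ) - α = -α + 1 by ring, Real.rpow_add hs, Real.rpow_one]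
  rw [e]
  exact Real.rpow_le_rpow hs.le hsT (by linarith)

/-- Hölder weights: `n^{1−α} ≤ T^{1−α}` for `0 ≤ n ≤ T`, `α ≤ 1`. [folklore] -/
private theorem rpow_one_sub_le {n T α : ℝ} (hn : 0 ≤ n) (hnT : n ≤ T) (hα : α ≤ 1) :
    n ^ (1 - α) ≤ T ^ (1 - α) :=
  Real.rpow_le_rpow hn hnT (by linarith)

/-- Hölder weights: `s^{−α}·n² = n^{1−α}·((n/s)^α·n)` (`n, s > 0`). [folklore] -/
private theorem rpow_weight_identity {n s α : ℝ} (hn : 0 < n) (hs : 0 < s) :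
    s ^ (-α) * (n * n) = n ^ (1 - α) * ((n / s) ^ α * n) := by
  rw [Real.div_rpow hn.le hs.le, Real.rpow_neg hs.le]
  have h1 : n ^ (1 - α) * n ^ α = n := by
    rw [← Real.rpow_add hn, sub_add_cancel, Real.rpow_one]
  rw [show n ^ (1 - α) * (n ^ α / s ^ α * n) = (n ^ (1 - α) * n ^ α) * n / s ^ α by ring, h1, div_eq_mul_inv]
  ring

/-- Hölder weights, far pairs: `s^{−α}·T ≤ L·T^{1−α}` when `T ≤ L·n`, `n ≤ s`, `0 ≤ α ≤ 1`, `L ≥ 1`, `n, T > 0`.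
[folklore] -/
private theorem rpow_far_le {n s T L α : ℝ} (hn : 0 < n) (hns : n ≤ s) (hT : 0 < T) (hTL : T ≤ L * n)
    (hL : 1 ≤ L) (hα0 : 0 ≤ α) (hα1 : α ≤ 1) : s ^ (-α) * T ≤ L * T ^ (1 - α) := by
  have hL0 : 0 < L := by linarith
  -- `s^{−α} ≤ n^{−α} ≤ (T/L)^{−α} = L^{α}·T^{−α} ≤ L·T^{−α}`
  have h1 : s ^ (-α) ≤ n ^ (-α) := Real.rpow_le_rpow_of_nonpos hn hns (by linarith)
  have hTLn : T / L ≤ n := by rw [div_le_iff₀ hL0]; linarith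
  have h2 : n ^ (-α) ≤ (T / L) ^ (-α) := Real.rpow_le_rpow_of_nonpos (div_pos hT hL0) hTLn (by linarith)
  have h3 : (T / L) ^ (-α) = L ^ α * T ^ (-α) := by
    rw [Real.div_rpow hT.le hL0.le, Real.rpow_neg hT.le, Real.rpow_neg hL0.le]
    field_simp
  have h4 : L ^ α ≤ L := B4Thm19ZeroBoxHolder.rpow_le_self_of_one_le hL hα1
  have h5 : T ^ (-α) * T = T ^ (1 - α) := by
    rw [show (1 : ℝ) - α = -α + 1 by ring, Real.rpow_add hT, Real.rpow_one]
  have hTα : 0 ≤ T ^ (-α) := Real.rpow_nonneg hT.le _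
  calc s ^ (-α) * T ≤ L ^ α * T ^ (-α) * T := by
        refine mul_le_mul_of_nonneg_right (h1.trans (h2.trans h3.le)) hT.le
    _ ≤ L * T ^ (-α) * T := by gcongr
    _ = L * T ^ (1 - α) := by rw [mul_assoc, h5]

end Tools

/-! ## §2 Geometry: the margin of `supp h_□` in its cube, the diameter of a block -/

section Geometry

variable {ℓ Mh k R : ℕ} {P : Fin (d + 1) → ℕ} {D : Domains d ℓ Mh k P R}

/-- **THE MARGIN OF THE CUT-OFF INSIDE ITS CUBE, EVERY MESH `k ≥ 0`** (the lineage's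
`B6Prop22HolderTwoLevelBox.exists_emb_eq_of_near` without its `1 ≤ k`): a site of `Ω` within `2n` fine sites (`n = L^k`)
of a site carrying `h_q` lies in the cut cube `□_q` — the support radius `⅝N` of `h_q` plus `2n ≤ N/3` stays below the
width `N = nLM_h ≥ 6n` of the cube (`LM_h ≥ 6`); the faces of `Ω` are faces of the cut cube.
[cite: Balaban1984PropagatorsI, (1.118) p.36 («h ∈ C₀^∞(]−⅔,⅔[)»); Balaban1983RegularityDecay, §2 p.575, (2.6) p.576] -/
theorem exists_emb_eq_of_near' {q : Fin (d + 1) → ℤ} (hℓ : 1 ≤ ℓ) (hMh : 3 ≤ Mh) (hP : ∀ i, 1 ≤ P i)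
    (hq : q ∈ ctrs P) {x p : ↥(Box d ℓ k (fun i => (ℓ + 1) * (Mh * P i)))} (hx : hΩ ℓ k Mh P q x ≠ 0)
    (hp : supNorm (p.1 - x.1) ≤ 2 * (((ℓ + 1) ^ k : ℕ) : ℝ)) : ∃ b, B6Eq238TwoLevelBox.emb ℓ k Mh P q hP hq b = p := by
  rw [B6Eq238TwoLevelBox.emb, ← B4SubBoxCarrier.inSub_iff]
  set N : ℕ := (ℓ + 1) ^ k * ((ℓ + 1) * Mh) with hNdef
  have hn1 : 1 ≤ (ℓ + 1) ^ k := Nat.one_le_pow _ _ (by omega)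
  have hLM : 6 ≤ (ℓ + 1) * Mh := by nlinarith
  have hN6 : 6 * (ℓ + 1) ^ k ≤ N := by
    rw [hNdef, Nat.mul_comm 6]
    exact Nat.mul_le_mul_left _ hLM
  have hN1 : 1 ≤ N := by nlinarith
  have hNr : (6 : ℝ) ≤ (N : ℝ) := by exact_mod_cast (show 6 ≤ N by nlinarith)
  have hN6r : 6 * (((ℓ + 1) ^ k : ℕ) : ℝ) ≤ (N : ℝ) := by exact_mod_cast hN6
  have hn1r : (1 : ℝ) ≤ (((ℓ + 1) ^ k : ℕ) : ℝ) := by exact_mod_cast hn1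
  have hpv := mem_boxDom.1 p.2
  intro i
  have hb : |B6Partition236TwoLevelBox.pos x.1 i - (N : ℝ) * (q i : ℝ)| < 5 / 8 * (N : ℝ) :=
    abs_lt_of_hq_ne_zero hN1 hx i
  rw [abs_lt] at hb
  simp only [B6Partition236TwoLevelBox.pos] at hb
  obtain ⟨hb1, hb2⟩ := hb
  have hpx : |(((p.1 i : ℤ) : ℝ)) - ((x.1 i : ℤ) : ℝ)| ≤ (N : ℝ) / 3 := by
    have h1 := (abs_le_supNorm (p.1 - x.1) i).trans hp
    rw [Pi.sub_apply, Int.cast_abs, Int.cast_sub] at h1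
    linarith
  rw [abs_le] at hpx
  obtain ⟨hpx1, hpx2⟩ := hpx
  obtain ⟨hp0, hp1⟩ := hpv i
  have hqi := (mem_ctrs.1 hq) i
  have elo : (((ℓ + 1) ^ k : ℕ) : ℤ) * (cubeO ℓ Mh q i : ℤ) = (N : ℤ) * (cubeLo q i : ℤ) := by
    simp only [cubeO, hNdef]; push_cast; ring
  have ehi : (((ℓ + 1) ^ k : ℕ) : ℤ) * ((cubeO ℓ Mh q i : ℤ) + (((ℓ + 1) * cubeM' Mh P q i : ℕ) : ℤ))
      = (N : ℤ) * ((cubeLo q i + cubeW P q i : ℕ) : ℤ) := by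
    simp only [cubeO, cubeM', hNdef]; push_cast; ring
  rw [elo, ehi, cubeLo_add_cubeW_eq hP hq, cubeLo_eq hq]
  have hp1' : p.1 i < (N : ℤ) * (P i : ℤ) := by
    have : (((ℓ + 1) ^ k * ((ℓ + 1) * (Mh * P i)) : ℕ) : ℤ) = (N : ℤ) * (P i : ℤ) := by
      rw [hNdef]; push_cast; ring
    rw [← this]; exact_mod_cast hp1
  constructor
  · rcases le_or_gt (q i) 0 with hq0 | hq0
    · have : q i = 0 := le_antisymm hq0 hqi.1
      rw [this]; simp; exact hp0
    · rw [max_eq_left (by omega)]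
      -- integrality: `p_i ≥ x_i − N/3 > Nq_i − ⅝N − ½ − N/3 = N(q_i − 1) + N/24 − ½ > N(q_i − 1) − 1`
      by_contra hcon
      push Not at hcon
      have h1 : p.1 i + 1 ≤ (N : ℤ) * (q i - 1) := Int.lt_iff_add_one_le.mp hcon
      have h2 : (((p.1 i : ℤ)) : ℝ) + 1 ≤ (N : ℝ) * (q i : ℝ) - (N : ℝ) := by
        have h3 := (Int.cast_le (R := ℝ)).mpr h1
        push_cast at h3
        have h4 : (N : ℝ) * ((q i : ℝ) - 1) = (N : ℝ) * (q i : ℝ) - (N : ℝ) := by ring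
        linarith
      have hN0 : (0 : ℝ) ≤ (N : ℝ) := Nat.cast_nonneg _
      linarith
  · rcases le_or_gt (P i : ℤ) (q i + 1) with hqP | hqP
    · rw [min_eq_right hqP]; exact hp1'
    · rw [min_eq_left hqP.le]
      have hr : ((p.1 i : ℤ) : ℝ) < ((N : ℤ) * (q i + 1) : ℝ) := by
        push_cast; nlinarith
      exact_mod_cast hr

/-- **THE [3] (2.6) MARGIN, TWO UNIT LENGTHS**: a box site within `2L^{i_□}` fine sites of a site carrying `h_□` lies
in the cube image (`M_h ≥ 3`). [cite: Balaban1983RegularityDecay, §2 p.575, (2.6) p.576; Balaban1984PropagatorsII, (2.36)–(2.37) p.229] -/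
theorem img_of_near (hℓ : 1 ≤ ℓ) (hP : ∀ μ, 1 ≤ P μ) (hMh : 3 ≤ Mh) (cq : ℕ × (Fin (d + 1) → ℤ))
    (hc : B6Eq238MultiLevelBoxL0.CubeData D cq) {z w : ↥(boxDom (N0 ℓ Mh k P))}
    (hu : uX (ℓ := ℓ) (Mh := Mh) (k := k) (P := P) cq z ≠ 0)
    (hw : supNorm (w.1 - z.1) ≤ 2 * (((ℓ + 1) ^ fin D cq.1 cq.2 : ℕ) : ℝ)) :
    ∃ b, embC D hP cq hc b = (castP (ℓ := ℓ) (Mh := Mh) (P := P) (fin_data hc).2.1 hc.hj.2).symm w := by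
  obtain ⟨-, hij, hji, -, -⟩ := fin_data hc
  have hjk := hc.hj.2
  have hMh1 : 1 ≤ Mh := le_trans (by norm_num) hMh
  have hMh2 : 2 ≤ Mh := le_trans (by norm_num) hMh
  have hMhP : 3 ≤ MhP ℓ Mh cq.1 (fin D cq.1 cq.2) := by
    unfold MhP
    calc 3 ≤ Mh := hMh
      _ = Mh * 1 := (mul_one _).symm
      _ ≤ Mh * (ℓ + 1) ^ (cq.1 - fin D cq.1 cq.2) := Nat.mul_le_mul_left _ (Nat.one_le_pow _ _ (by omega))
  have hzP : z.1 ∈ Box d ℓ (fin D cq.1 cq.2)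
      (fun μ => (ℓ + 1) * (MhP ℓ Mh cq.1 (fin D cq.1 cq.2) * Pj ℓ k P cq.1 μ)) :=
    mem_boxDom_of_eq (Np_eq hij hjk).symm z.2
  have hΩz : hΩ ℓ (fin D cq.1 cq.2) (MhP ℓ Mh cq.1 (fin D cq.1 cq.2)) (Pj ℓ k P cq.1) cq.2 ⟨z.1, hzP⟩ ≠ 0 := by
    rw [← uFun_eq_hΩ hij cq.2 ⟨z.1, hzP⟩]; exact hu
  have hwval : ((castP (ℓ := ℓ) (Mh := Mh) (P := P) hij hjk).symm w).1 = w.1 := by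
    unfold castP; exact boxCast_symm_apply_val _ _
  have hw' : supNorm (((castP (ℓ := ℓ) (Mh := Mh) (P := P) hij hjk).symm w).1
      - (⟨z.1, hzP⟩ : ↥(Box d ℓ (fin D cq.1 cq.2)
          (fun μ => (ℓ + 1) * (MhP ℓ Mh cq.1 (fin D cq.1 cq.2) * Pj ℓ k P cq.1 μ)))).1)
      ≤ 2 * (((ℓ + 1) ^ fin D cq.1 cq.2 : ℕ) : ℝ) := by
    rw [hwval]; exact hw
  exact exists_emb_eq_of_near' hℓ hMhP (one_le_Pj hP cq.1) hc.hq hΩz hw'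

/-- **TWO SITES OF ONE BLOCK `B^j(y)` ARE AT SUP-DISTANCE `≤ L^j − 1`**. [cite: Balaban1984PropagatorsII, (2.1) p.224, dictionary] -/
theorem supNorm_le_of_blkOf_eq {x x' : ↥(boxDom (N0 ℓ Mh k P))} (h : blkOf D x' = blkOf D x) :
    supNorm (x'.1 - x.1) ≤ (((ℓ + 1) ^ (B6MultiLevelBoxOperatorL0.Domains.lev D) x.1 : ℕ) : ℝ) - 1 := by
  have h1 := dist_toR_cen_le D h
  have h2 := dist_toR_cen_le D (rfl : blkOf D x = blkOf D x)
  have hlev : (blkOf D x).1.1 = D.lev x.1 := rfl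
  rw [hlev] at h1 h2
  rw [supNorm_eq_dist]
  calc dist (toR x'.1) (toR x.1) ≤ dist (toR x'.1) (cen D (blkOf D x)) + dist (cen D (blkOf D x)) (toR x.1) :=
        dist_triangle _ _ _
    _ ≤ ((((ℓ + 1) ^ D.lev x.1 : ℕ) : ℝ) - 1) / 2 + ((((ℓ + 1) ^ D.lev x.1 : ℕ) : ℝ) - 1) / 2 := by
        rw [dist_comm (cen D (blkOf D x))]; exact add_le_add h1 h2
    _ = (((ℓ + 1) ^ D.lev x.1 : ℕ) : ℝ) - 1 := by ring

end Geometry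

/-! ## §3 One term of `∂G′₀` at one bond (file 6's per-term bound, exported for the far pairs) -/

section SingleDiff

variable {ℓ Mh k R : ℕ} {P : Fin (d + 1) → ℕ}

/-- **ONE TERM OF `∂G′₀` AT ONE BOND** (file 6's per-term bound, exported for the Hölder bookkeeping): there are
`δ₃, Q > 0` (functions of `d`, `ℓ`, windows) such that for every member `□` of the cover, every box site `x` with
`x + e_μ` in the box and every `λ` supported in the block `y′` with `|λ| ≤ B`:
`|(h_□G′(□)v_□λ)(x + e_μ) − (h_□G′(□)v_□λ)(x)| ≤ L^{j(x)}·Q·e^{−δ₃d(y(x),y′)/(d+1)}·B`.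
[cite: Balaban1984PropagatorsII, (2.43) p.230, (2.66)–(2.67) p.234, dictionary] -/
theorem aX_diff_le (d ℓ : ℕ) (hℓ : 1 ≤ ℓ) (aminus aplus a2minus a2plus : ℝ) (ha : 0 < aminus) (ha2 : 0 < a2minus) :
    ∃ δ₃ Q : ℝ, 0 < δ₃ ∧ 0 < Q ∧ ∀ (k Mh R : ℕ), 3 ≤ Mh → 2 * (ℓ + 1) ≤ R →
      ∀ (P : Fin (d + 1) → ℕ) (hP : ∀ μ, 1 ≤ P μ) (D : Domains d ℓ Mh k P R) (a c : ℕ → ℝ),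
        (∀ i, aminus ≤ a i ∧ a i ≤ aplus) → (∀ i, a2minus ≤ c i ∧ c i ≤ a2plus) →
        ∀ (μ : Fin (d + 1)) (y' : ↥(bset D)) (lam : ↥(boxDom (N0 ℓ Mh k P)) → ℝ) (B : ℝ),
          BlockSupp (g := geom D) (blkOf D) lam y' B →
          ∀ (x : ↥(boxDom (N0 ℓ Mh k P))) (hxe : x.1 + Pi.single μ 1 ∈ boxDom (N0 ℓ Mh k P))
            (cq : ℕ × (Fin (d + 1) → ℤ)) (hc : CubeData D cq),
            |(aX D a c hP cq hc *ᵥ lam) ⟨x.1 + Pi.single μ 1, hxe⟩ - (aX D a c hP cq hc *ᵥ lam) x|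
              ≤ ((ℓ : ℝ) + 1) ^ D.lev x.1
                * (Q * Real.exp (-(δ₃ / (d + 1) * (geom D).dist (blkOf D x) y')) * B) := by
  obtain ⟨δ'', c', hδ'', hc', h243⟩ := ineq243_twoLevel_roww d ℓ hℓ aminus aplus 0 a2minus a2plus ha ha2
  obtain ⟨δd, cd, hδd, hcd, h243d⟩ := ineq243_twoLevel_deriv_wsum d ℓ hℓ aminus aplus 0 a2minus a2plus ha ha2
  have hD1 := D1_nonneg contDiff_hprof hasCompactSupport_hprof
  set δ₃ : ℝ := min δ'' δd with hδ₃
  have hδ₃pos : 0 < δ₃ := lt_min hδ'' hδd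
  set Q : ℝ := (d + 1) * D1 hprof * (c' * (Real.exp δ'' * Real.exp δ'')) + cd * Real.exp δd + 1 with hQ
  have hQ0 : 0 < Q := by positivity
  refine ⟨δ₃, Q, hδ₃pos, hQ0, ?_⟩
  intro k Mh R hMh hR P hP D a c haw hcw μ y' lam B hlam x hxe cq hc
  have hMh1 : 1 ≤ Mh := le_trans (by norm_num) hMh
  have hMh2 : 2 ≤ Mh := le_trans (by norm_num) hMh
  have hL1 : (1 : ℝ) ≤ (ℓ : ℝ) + 1 := by linarith [(Nat.cast_nonneg ℓ : (0 : ℝ) ≤ ℓ)]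
  have hlamB : ∀ w, |lam w| ≤ B := fun w => BlockSupp.abs_le hlam w
  have hB0 : 0 ≤ B := hlam.nonneg
  set dist0 : ℝ := (((bond D).dist (blkOf D x) y' : ℕ) : ℝ) with hdist0
  have hgeom : (geom D).dist (blkOf D x) y' = dist0 := rfl
  have hdist0nn : 0 ≤ dist0 := by positivity
  rw [hgeom]
  set xe : ↥(boxDom (N0 ℓ Mh k P)) := ⟨x.1 + Pi.single μ 1, hxe⟩ with hxedef
  have hxe1 : xe.1 = x.1 + Pi.single μ 1 := rfl
  set E : ℝ := ((ℓ : ℝ) + 1) ^ D.lev x.1 * (Q * Real.exp (-(δ₃ / (d + 1) * dist0)) * B) with hE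
  have hE0 : 0 ≤ E := by positivity
  have hQle : (d + 1) * D1 hprof * (c' * (Real.exp δ'' * Real.exp δ'')) + cd * Real.exp δd ≤ Q := by
    rw [hQ]; linarith
  show |(aX D a c hP cq hc *ᵥ lam) xe - (aX D a c hP cq hc *ᵥ lam) x| ≤ E
  obtain ⟨-, hij, hji, -, -⟩ := fin_data hc
  have hjk := hc.hj.2
  by_cases h0 : uX (ℓ := ℓ) (Mh := Mh) (k := k) (P := P) cq x = 0
      ∧ uX (ℓ := ℓ) (Mh := Mh) (k := k) (P := P) cq xe = 0
  · rw [aX_mulVec_apply, aX_mulVec_apply, h0.1, h0.2, zero_mul, zero_mul, sub_zero, abs_zero]; exact hE0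
  have hor : uX (ℓ := ℓ) (Mh := Mh) (k := k) (P := P) cq x ≠ 0
      ∨ uX (ℓ := ℓ) (Mh := Mh) (k := k) (P := P) cq xe ≠ 0 := by
    by_contra h'; push Not at h'; exact h0 ⟨by tauto, by tauto⟩
  -- both ends of the bond lie in the cube image
  have hxe_nb : xe.1 ∈ nbrs x.1 := mem_nbrs.2 ⟨μ, Or.inl hxe1⟩
  have hx_nb : x.1 ∈ nbrs xe.1 := mem_nbrs.2 ⟨μ, Or.inr (by rw [hxe1, add_sub_cancel_right])⟩
  obtain ⟨y, hy⟩ : ∃ y, embC D hP cq hc y = (castP (ℓ := ℓ) (Mh := Mh) (P := P) hij hjk).symm x := by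
    rcases hor with h | h
    · exact img_of_uX_ne_zero hℓ hP hMh2 cq hc h (Or.inr rfl)
    · exact img_of_uX_ne_zero hℓ hP hMh2 cq hc h (Or.inl hx_nb)
  obtain ⟨ye, hye⟩ : ∃ ye, embC D hP cq hc ye = (castP (ℓ := ℓ) (Mh := Mh) (P := P) hij hjk).symm xe := by
    rcases hor with h | h
    · exact img_of_uX_ne_zero hℓ hP hMh2 cq hc h (Or.inl hxe_nb)
    · exact img_of_uX_ne_zero hℓ hP hMh2 cq hc h (Or.inr rfl)
  have hzval : ∀ w : ↥(boxDom (N0 ℓ Mh k P)), ((castP (ℓ := ℓ) (Mh := Mh) (P := P) hij hjk).symm w).1 = w.1 :=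
    fun w => by unfold castP; exact boxCast_symm_apply_val _ _
  have hyx : (embC D hP cq hc y).1 = x.1 := by rw [hy, hzval]
  have hyexe : (embC D hP cq hc ye).1 = xe.1 := by rw [hye, hzval]
  have hyey : ye.1 = y.1 + Pi.single μ 1 := by
    have h1 : (embC D hP cq hc ye).1 - (embC D hP cq hc y).1 = ye.1 - y.1 := by
      unfold embC; exact emb_sub_emb _ hc.hq ye y
    rw [hyexe, hyx, hxe1, add_sub_cancel_left, eq_comm, sub_eq_iff_eq_add'] at h1
    exact h1
  have hxin : InCube ℓ Mh k P cq.1 cq.2 x.1 := by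
    rw [← hzval x]
    exact (inCube_iff_exists_emb (Mh := Mh) hP hij hc.hq _).2 ⟨y, hy⟩
  have hlevwin := lev_window_of_inCube hℓ hR hP hMh2 hc x.2 hxin
  have hMh' : 1 ≤ MhP ℓ Mh cq.1 (fin D cq.1 cq.2) := one_le_MhP hMh1 _ _
  have hcM' : ∀ ν, 1 ≤ cubeM' (MhP ℓ Mh cq.1 (fin D cq.1 cq.2)) (Pj ℓ k P cq.1) cq.2 ν := fun ν =>
    Nat.one_le_iff_ne_zero.2 (Nat.mul_ne_zero_iff.2
      ⟨by omega, by have := (one_le_cubeW (one_le_Pj hP cq.1) hc.hq ν).1; omega⟩)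
  have hn : (0 : ℝ) < (((ℓ + 1) ^ fin D cq.1 cq.2 : ℕ) : ℝ) := by positivity
  have hn1 : (1 : ℝ) ≤ (((ℓ + 1) ^ fin D cq.1 cq.2 : ℕ) : ℝ) := by
    exact_mod_cast Nat.one_le_pow _ _ (by omega)
  have hncast : (((ℓ + 1) ^ fin D cq.1 cq.2 : ℕ) : ℝ) = ((ℓ : ℝ) + 1) ^ fin D cq.1 cq.2 := by push_cast; ring
  set Dd : ℝ := (((ℓ + 1) ^ fin D cq.1 cq.2 : ℕ) : ℝ) * (dist0 / (d + 1) - 1) with hDd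
  -- the vector `u = res(v_□λ ∘ cast)` on the cube, its bound and its support distance from `y`
  have hF : ∀ b, |(res (embC D hP cq hc) *ᵥ ((Matrix.diagonal (vX D cq) *ᵥ lam) ∘ castP (fin_data hc).2.1 hc.hj.2)) b|
      ≤ B := by
    intro b
    rw [res_mulVec, Function.comp_apply, Matrix.mulVec_diagonal, abs_mul]
    calc |vX D cq _| * |lam _| ≤ 1 * B := mul_le_mul (abs_vFun_le_one _ _ _) (hlamB _) (abs_nonneg _) zero_le_one
      _ = B := one_mul _
  have hD : ∀ b, (res (embC D hP cq hc) *ᵥ ((Matrix.diagonal (vX D cq) *ᵥ lam) ∘ castP (fin_data hc).2.1 hc.hj.2)) b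
      ≠ 0 → Dd ≤ supNorm (y.1 - b.1) := by
    intro b hb
    rw [res_mulVec, Function.comp_apply, Matrix.mulVec_diagonal] at hb
    set x'' : ↥(boxDom (N0 ℓ Mh k P)) := castP (fin_data hc).2.1 hc.hj.2 (embC D hP cq hc b) with hx''
    have hμx : lam x'' ≠ 0 := fun h0 => hb (by rw [h0, mul_zero])
    have hx''val : x''.1 = (embC D hP cq hc b).1 := by
      rw [hx'']; unfold castP; exact boxCast_apply_val _ _
    have hx''in : InCube ℓ Mh k P cq.1 cq.2 x''.1 := by
      rw [hx''val]
      exact (inCube_iff_exists_emb (Mh := Mh) hP hij hc.hq _).2 ⟨b, rfl⟩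
    have hblk : blkOf D x'' = y' := by
      by_contra hne
      exact hμx (hlam.off x'' hne)
    have h := Dd_le_supNorm hℓ hR hP hMh2 hc x x'' hxin hx''in y' hblk
    have hsub : x.1 - x''.1 = y.1 - b.1 := by
      rw [hx''val, ← hyx]; unfold embC; exact emb_sub_emb _ hc.hq y b
    rw [hsub] at h
    exact h
  have hD' : ∀ b, (res (embC D hP cq hc) *ᵥ ((Matrix.diagonal (vX D cq) *ᵥ lam) ∘ castP (fin_data hc).2.1 hc.hj.2)) b
      ≠ 0 → Dd - 1 ≤ supNorm (ye.1 - b.1) := by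
    intro b hb
    have h1 := hD b hb
    have h2 := supNorm_sub_le_nbr (x' := b.1) hyey
    linarith
  -- (2.43)₁ at `x + e_μ` on the cube, in the decaying form
  have hrow : roww δ'' ((ℓ + 1) ^ fin D cq.1 cq.2) (cG D a c cq.1 (fin D cq.1 cq.2) cq.2 hP hc.hq) ye ≤ c' :=
    h243 (fin D cq.1 cq.2) (a (fin D cq.1 cq.2)) 0 (c (fin D cq.1 cq.2)) (haw _).1 (haw _).2 le_rfl
      le_rfl (hcw _).1 (hcw _).2 _ hcM' _ ye
  have hval := mulVec_le_of_roww hδ''.le ((ℓ + 1) ^ fin D cq.1 cq.2)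
    (cG D a c cq.1 (fin D cq.1 cq.2) cq.2 hP hc.hq) ye hrow _ hF hD'
  have hval' : |(cG D a c cq.1 (fin D cq.1 cq.2) cq.2 hP hc.hq
        *ᵥ (res (embC D hP cq hc) *ᵥ ((Matrix.diagonal (vX D cq) *ᵥ lam) ∘ castP (fin_data hc).2.1 hc.hj.2))) ye|
      ≤ c' * (Real.exp δ'' * Real.exp δ'') * Real.exp (-(δ₃ / (d + 1) * dist0)) * B := by
    refine hval.trans ?_
    have h1 : Real.exp (-(δ'' * (Dd - 1) / (((ℓ + 1) ^ fin D cq.1 cq.2 : ℕ) : ℝ)))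
        ≤ Real.exp δ'' * Real.exp δ'' * Real.exp (-(δ₃ / (d + 1) * dist0)) := by
      refine (exp_shift_le hδ''.le hn1).trans ?_
      rw [hDd, exp_Dd_eq hn d, mul_assoc]
      exact mul_le_mul_of_nonneg_left (mul_le_mul_of_nonneg_left
        (exp_rate_mono (min_le_left _ _) hdist0nn d) (Real.exp_pos _).le) (Real.exp_pos _).le
    calc c' * Real.exp (-(δ'' * (Dd - 1) / (((ℓ + 1) ^ fin D cq.1 cq.2 : ℕ) : ℝ))) * B
        ≤ c' * (Real.exp δ'' * Real.exp δ'' * Real.exp (-(δ₃ / (d + 1) * dist0))) * B :=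
          mul_le_mul_of_nonneg_right (mul_le_mul_of_nonneg_left h1 hc'.le) hB0
      _ = c' * (Real.exp δ'' * Real.exp δ'') * Real.exp (-(δ₃ / (d + 1) * dist0)) * B := by ring
  -- (2.43)₂ at `x` on the cube, in the decaying form
  have hwrow := h243d (fin D cq.1 cq.2) (a (fin D cq.1 cq.2)) 0 (c (fin D cq.1 cq.2)) (haw _).1
    (haw _).2 le_rfl le_rfl (hcw _).1 (hcw _).2 _ hcM'
    (lamLoc ℓ (MhP ℓ Mh cq.1 (fin D cq.1 cq.2)) (Pj ℓ k P cq.1) cq.2 (one_le_Pj hP cq.1) hc.hq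
      (LamG D cq.1 (fin D cq.1 cq.2))) μ y ye hyey
  have hder := sum_mul_le_of_wrow hn hB0
    (fun z => (((ℓ + 1) ^ fin D cq.1 cq.2 : ℕ) : ℝ)
      * (cG D a c cq.1 (fin D cq.1 cq.2) cq.2 hP hc.hq ye z - cG D a c cq.1 (fin D cq.1 cq.2) cq.2 hP hc.hq y z))
    (res (embC D hP cq hc) *ᵥ ((Matrix.diagonal (vX D cq) *ᵥ lam) ∘ castP (fin_data hc).2.1 hc.hj.2))
    (fun z => supNorm (y.1 - z.1)) hwrow hF hD hδd.le
  have hder' : |(((ℓ + 1) ^ fin D cq.1 cq.2 : ℕ) : ℝ)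
        * ((cG D a c cq.1 (fin D cq.1 cq.2) cq.2 hP hc.hq
            *ᵥ (res (embC D hP cq hc) *ᵥ ((Matrix.diagonal (vX D cq) *ᵥ lam) ∘ castP (fin_data hc).2.1 hc.hj.2))) ye
          - (cG D a c cq.1 (fin D cq.1 cq.2) cq.2 hP hc.hq
            *ᵥ (res (embC D hP cq hc) *ᵥ ((Matrix.diagonal (vX D cq) *ᵥ lam) ∘ castP (fin_data hc).2.1 hc.hj.2))) y)|
      ≤ cd * Real.exp δd * Real.exp (-(δ₃ / (d + 1) * dist0)) * B := by
    have hsum : (((ℓ + 1) ^ fin D cq.1 cq.2 : ℕ) : ℝ)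
        * ((cG D a c cq.1 (fin D cq.1 cq.2) cq.2 hP hc.hq
            *ᵥ (res (embC D hP cq hc) *ᵥ ((Matrix.diagonal (vX D cq) *ᵥ lam) ∘ castP (fin_data hc).2.1 hc.hj.2))) ye
          - (cG D a c cq.1 (fin D cq.1 cq.2) cq.2 hP hc.hq
            *ᵥ (res (embC D hP cq hc) *ᵥ ((Matrix.diagonal (vX D cq) *ᵥ lam) ∘ castP (fin_data hc).2.1 hc.hj.2))) y)
        = ∑ z, (((ℓ + 1) ^ fin D cq.1 cq.2 : ℕ) : ℝ)
            * (cG D a c cq.1 (fin D cq.1 cq.2) cq.2 hP hc.hq ye z - cG D a c cq.1 (fin D cq.1 cq.2) cq.2 hP hc.hq y z)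
            * (res (embC D hP cq hc) *ᵥ ((Matrix.diagonal (vX D cq) *ᵥ lam) ∘ castP (fin_data hc).2.1 hc.hj.2)) z := by
      simp only [Matrix.mulVec, dotProduct]
      rw [← Finset.sum_sub_distrib, Finset.mul_sum]
      refine Finset.sum_congr rfl fun z _ => ?_
      ring
    rw [hsum]
    refine hder.trans ?_
    have h1 : Real.exp (-(δd * Dd / (((ℓ + 1) ^ fin D cq.1 cq.2 : ℕ) : ℝ)))
        ≤ Real.exp δd * Real.exp (-(δ₃ / (d + 1) * dist0)) := by
      rw [hDd, exp_Dd_eq hn d]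
      exact mul_le_mul_of_nonneg_left (exp_rate_mono (min_le_right _ _) hdist0nn d) (Real.exp_pos _).le
    calc cd * Real.exp (-(δd * Dd / (((ℓ + 1) ^ fin D cq.1 cq.2 : ℕ) : ℝ))) * B
        ≤ cd * (Real.exp δd * Real.exp (-(δ₃ / (d + 1) * dist0))) * B :=
          mul_le_mul_of_nonneg_right (mul_le_mul_of_nonneg_left h1 hcd.le) hB0
      _ = cd * Real.exp δd * Real.exp (-(δ₃ / (d + 1) * dist0)) * B := by ring
  -- `|h_□| ≤ 1`, `|∂h_□| ≤ (d+1)D₁/L^{j_□}`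
  have huXx : |uX (ℓ := ℓ) (Mh := Mh) (k := k) (P := P) cq x| ≤ 1 := abs_hq_le_one _ _ _ _
  have hNj1 : 1 ≤ (ℓ + 1) ^ cq.1 := Nat.one_le_pow _ _ (by omega)
  have hM1 : 1 ≤ (ℓ + 1) * Mh := by nlinarith
  have hdu : |uX (ℓ := ℓ) (Mh := Mh) (k := k) (P := P) cq xe - uX (ℓ := ℓ) (Mh := Mh) (k := k) (P := P) cq x|
      ≤ (d + 1) * D1 hprof / (((ℓ + 1) ^ cq.1 : ℕ) : ℝ) := by
    have h := abs_hq_sub_le (d := d) hNj1 hM1 cq.2 x.1 xe.1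
    have hs : supNorm (xe.1 - x.1) ≤ 1 := by
      rw [hxe1, add_sub_cancel_left]; exact supNorm_single_le μ
    have hMr : (1 : ℝ) ≤ (((ℓ + 1) * Mh : ℕ) : ℝ) := by exact_mod_cast hM1
    have hnj : (0 : ℝ) < (((ℓ + 1) ^ cq.1 : ℕ) : ℝ) := by positivity
    have hA0 : 0 ≤ (d + 1) * D1 hprof / (((ℓ + 1) * Mh : ℕ) : ℝ) := by positivity
    have h5 : (d + 1) * D1 hprof / (((ℓ + 1) * Mh : ℕ) : ℝ) * supNorm (xe.1 - x.1) ≤ (d + 1) * D1 hprof :=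
      calc (d + 1) * D1 hprof / (((ℓ + 1) * Mh : ℕ) : ℝ) * supNorm (xe.1 - x.1)
          ≤ (d + 1) * D1 hprof / (((ℓ + 1) * Mh : ℕ) : ℝ) * 1 := mul_le_mul_of_nonneg_left hs hA0
        _ = (d + 1) * D1 hprof / (((ℓ + 1) * Mh : ℕ) : ℝ) := mul_one _
        _ ≤ (d + 1) * D1 hprof := div_le_self (by positivity) hMr
    exact h.trans (div_le_div_of_nonneg_right h5 hnj.le)
  -- the lattice-unit factors `n²/L^{j_□} ≤ n ≤ L^{lev x}`
  have hnle : (((ℓ + 1) ^ fin D cq.1 cq.2 : ℕ) : ℝ) ≤ ((ℓ : ℝ) + 1) ^ D.lev x.1 := by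
    rw [hncast]; exact pow_le_pow_right₀ hL1 hlevwin.1
  have hsq : (((ℓ + 1) ^ fin D cq.1 cq.2 : ℕ) : ℝ) * (((ℓ + 1) ^ fin D cq.1 cq.2 : ℕ) : ℝ)
      / (((ℓ + 1) ^ cq.1 : ℕ) : ℝ) ≤ ((ℓ : ℝ) + 1) ^ D.lev x.1 := by
    have hnj : (0 : ℝ) < (((ℓ + 1) ^ cq.1 : ℕ) : ℝ) := by positivity
    have h2 : (((ℓ + 1) ^ cq.1 : ℕ) : ℝ) = ((ℓ : ℝ) + 1) ^ cq.1 := by push_cast; ring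
    rw [div_le_iff₀ hnj, hncast, ← pow_add, h2, ← pow_add]
    exact pow_le_pow_right₀ hL1 (by omega)
  -- assembling the product rule
  rw [aX_mulVec_apply, aX_mulVec_apply, gX_row_img hP cq hc _ hye, gX_row_img hP cq hc _ hy]
  obtain ⟨gye, hgye⟩ : ∃ t : ℝ, t = (cG D a c cq.1 (fin D cq.1 cq.2) cq.2 hP hc.hq
      *ᵥ (res (embC D hP cq hc) *ᵥ ((Matrix.diagonal (vX D cq) *ᵥ lam) ∘ castP (fin_data hc).2.1 hc.hj.2))) ye :=
    ⟨_, rfl⟩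
  obtain ⟨gy, hgy⟩ : ∃ t : ℝ, t = (cG D a c cq.1 (fin D cq.1 cq.2) cq.2 hP hc.hq
      *ᵥ (res (embC D hP cq hc) *ᵥ ((Matrix.diagonal (vX D cq) *ᵥ lam) ∘ castP (fin_data hc).2.1 hc.hj.2))) y :=
    ⟨_, rfl⟩
  rw [← hgye] at hval' hder' ⊢
  rw [← hgy] at hder' ⊢
  obtain ⟨nn, hnn⟩ : ∃ t : ℝ, t = (((ℓ + 1) ^ fin D cq.1 cq.2 : ℕ) : ℝ) := ⟨_, rfl⟩
  have hn2eq : ((((ℓ : ℝ) + 1)) ^ fin D cq.1 cq.2) ^ 2 = nn * nn := by rw [hnn, hncast]; ring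
  rw [← hnn] at hder' hnle hsq
  rw [hn2eq]
  have hnn0 : 0 ≤ nn := by rw [hnn]; positivity
  have hsplit : uX (ℓ := ℓ) (Mh := Mh) (k := k) (P := P) cq xe * (nn * nn * gye)
        - uX (ℓ := ℓ) (Mh := Mh) (k := k) (P := P) cq x * (nn * nn * gy)
      = (uX (ℓ := ℓ) (Mh := Mh) (k := k) (P := P) cq xe - uX (ℓ := ℓ) (Mh := Mh) (k := k) (P := P) cq x)
          * (nn * nn * gye)
        + uX (ℓ := ℓ) (Mh := Mh) (k := k) (P := P) cq x * (nn * (nn * (gye - gy))) := by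
    ring
  rw [hsplit]
  have hR1 : 0 ≤ c' * (Real.exp δ'' * Real.exp δ'') * Real.exp (-(δ₃ / (d + 1) * dist0)) * B := by positivity
  have hR2 : 0 ≤ cd * Real.exp δd * Real.exp (-(δ₃ / (d + 1) * dist0)) * B := by positivity
  have hA1 : |(uX (ℓ := ℓ) (Mh := Mh) (k := k) (P := P) cq xe - uX (ℓ := ℓ) (Mh := Mh) (k := k) (P := P) cq x)
        * (nn * nn * gye)|
      ≤ ((ℓ : ℝ) + 1) ^ D.lev x.1
          * ((d + 1) * D1 hprof * (c' * (Real.exp δ'' * Real.exp δ'')) * Real.exp (-(δ₃ / (d + 1) * dist0)) * B) := by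
    rw [abs_mul, abs_mul, abs_of_nonneg (mul_nonneg hnn0 hnn0)]
    have hdu0 : 0 ≤ (d + 1) * D1 hprof / (((ℓ + 1) ^ cq.1 : ℕ) : ℝ) := by positivity
    calc |uX cq xe - uX cq x| * (nn * nn * |gye|)
        ≤ ((d + 1) * D1 hprof / (((ℓ + 1) ^ cq.1 : ℕ) : ℝ))
            * (nn * nn * (c' * (Real.exp δ'' * Real.exp δ'') * Real.exp (-(δ₃ / (d + 1) * dist0)) * B)) :=
          mul_le_mul hdu (mul_le_mul_of_nonneg_left hval' (mul_nonneg hnn0 hnn0)) (by positivity) hdu0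
      _ = (nn * nn / (((ℓ + 1) ^ cq.1 : ℕ) : ℝ))
            * ((d + 1) * D1 hprof * (c' * (Real.exp δ'' * Real.exp δ'')) * Real.exp (-(δ₃ / (d + 1) * dist0)) * B) := by
          ring
      _ ≤ ((ℓ : ℝ) + 1) ^ D.lev x.1
            * ((d + 1) * D1 hprof * (c' * (Real.exp δ'' * Real.exp δ'')) * Real.exp (-(δ₃ / (d + 1) * dist0)) * B) :=
          mul_le_mul_of_nonneg_right hsq (by positivity)
  have hA2 : |uX (ℓ := ℓ) (Mh := Mh) (k := k) (P := P) cq x * (nn * (nn * (gye - gy)))|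
      ≤ ((ℓ : ℝ) + 1) ^ D.lev x.1 * (cd * Real.exp δd * Real.exp (-(δ₃ / (d + 1) * dist0)) * B) := by
    rw [abs_mul, abs_mul, abs_of_nonneg hnn0]
    calc |uX cq x| * (nn * |nn * (gye - gy)|)
        ≤ 1 * (((ℓ : ℝ) + 1) ^ D.lev x.1 * (cd * Real.exp δd * Real.exp (-(δ₃ / (d + 1) * dist0)) * B)) :=
          mul_le_mul huXx (mul_le_mul hnle hder' (abs_nonneg _) (by positivity)) (by positivity) zero_le_one
      _ = ((ℓ : ℝ) + 1) ^ D.lev x.1 * (cd * Real.exp δd * Real.exp (-(δ₃ / (d + 1) * dist0)) * B) := one_mul _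
  refine (abs_add_le _ _).trans ?_
  refine (add_le_add hA1 hA2).trans ?_
  rw [hE, ← mul_add]
  refine mul_le_mul_of_nonneg_left ?_ (by positivity)
  have hsplit : (d + 1) * D1 hprof * (c' * (Real.exp δ'' * Real.exp δ'')) * Real.exp (-(δ₃ / (d + 1) * dist0)) * B
      + cd * Real.exp δd * Real.exp (-(δ₃ / (d + 1) * dist0)) * B
      = ((d + 1) * D1 hprof * (c' * (Real.exp δ'' * Real.exp δ'')) + cd * Real.exp δd)
        * (Real.exp (-(δ₃ / (d + 1) * dist0)) * B) := by ring
  rw [hsplit, mul_assoc Q]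
  exact mul_le_mul_of_nonneg_right hQle (by positivity)

end SingleDiff

/-! ## §4 One cube term over a near pair: the four-term product rule -/

section NearTerm

variable {ℓ Mh k R : ℕ} {P : Fin (d + 1) → ℕ} {D : Domains d ℓ Mh k P R} {a c : ℕ → ℝ}

/-- the sixteen distances of the quadruple `x, x+e_μ, x′, x′+e_μ` are `≤ |x′−x|_∞ + 1`. [folklore] -/
private theorem quad_dist_le {μ : Fin (d + 1)} (x xe x' xe' : Fin (d + 1) → ℤ) (hxe : xe = x + Pi.single μ 1)
    (hxe' : xe' = x' + Pi.single μ 1) (t w : Fin (d + 1) → ℤ) (ht : t = x ∨ t = xe ∨ t = x' ∨ t = xe')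
    (hw : w = x ∨ w = xe ∨ w = x' ∨ w = xe') : supNorm (t - w) ≤ supNorm (x' - x) + 1 := by
  have hsym : ∀ a b : Fin (d + 1) → ℤ, supNorm (a - b) = supNorm (b - a) := fun a b => by
    rw [← B4TorusKernel.supNorm_neg, neg_sub]
  have hself : ∀ a : Fin (d + 1) → ℤ, supNorm (a - a) = 0 := fun a => by
    rw [sub_self]; exact B4BoxCov237.supNorm_zero'
  have h0 : 0 ≤ supNorm (x' - x) := supNorm_nonneg _
  have h1 : supNorm (xe - x) ≤ 1 := by rw [hxe, add_sub_cancel_left]; exact supNorm_single_le μ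
  have h2 : supNorm (xe' - x') ≤ 1 := by rw [hxe', add_sub_cancel_left]; exact supNorm_single_le μ
  have h3 : supNorm (xe' - xe) = supNorm (x' - x) := by rw [hxe, hxe']; congr 1; abel
  have h4 : supNorm (xe' - x) ≤ supNorm (xe' - x') + supNorm (x' - x) := supNorm_sub_le_sub_add_sub _ _ _
  have h5 : supNorm (x' - xe) ≤ supNorm (x' - x) + supNorm (x - xe) := supNorm_sub_le_sub_add_sub _ _ _
  have h1' := hsym xe x
  have h2' := hsym xe' x'
  have h3' := hsym xe' xe
  have h4' := hsym xe' x
  have h5' := hsym x' xe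
  have h6' := hsym x' x
  rcases ht with rfl | rfl | rfl | rfl <;> rcases hw with rfl | rfl | rfl | rfl <;>
    first | (rw [hself]; linarith) | linarith

set_option maxHeartbeats 1600000 in
/-- **ONE CUBE TERM OVER A NEAR PAIR** (`|x′−x|_∞ + 1 ≤ 2L^{i_□}`, one of the four points carrying `h_□`), deterministic
form: given the three cube-level inputs for `G′(□)` — rows `≤ c′` ((2.43)₁, rate `δ₁`), differenced rows `≤ c_d`
((2.43)₂, rate `δ₂`), Hölder-weighted doubly differenced rows `≤ c_H` ([3] (1.9) for the cube, rate `δ₃`) — and a common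
rate `δ₄ ≤ δ₁, δ₂, δ₃`, the Hölder-weighted mixed difference of `h_□G′(□)v_□λ` over `x, x+e_μ, x′, x′+e_μ` against a
vector `λ` supported in the block `y′`, `|λ| ≤ B`, is
`≤ (L^{j})^{1−α}·Q_near·e^{−(δ₄/(d+1))d(y,y′)}·B` (`x, x′ ∈ B^j(y)`), `Q_near` explicit — the four terms of the
product rule: `dd h_□ = O(s/N²)` times a row, `(h_□(x′)−h_□(x)) = O(s/N)` times a differenced row,
`∂h_□ = O(1/N)` times a long difference (`O(s)` differenced rows, telescoped), `h_□` times the Hölder clause.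
[cite: Balaban1984PropagatorsII, (2.64) p.234 with «… for a Hölder norm of a derivative … (L^jη)^{1−α}», (2.43) p.230; Balaban1983RegularityDecay, Theorem (1.9) p.573, §2 pp.575–577] -/
theorem aX_dd_near_le (hℓ : 1 ≤ ℓ) (hMh : 3 ≤ Mh) (hR : 2 * (ℓ + 1) ≤ R) (hP : ∀ μ, 1 ≤ P μ)
    (cq : ℕ × (Fin (d + 1) → ℤ)) (hc : B6Eq238MultiLevelBoxL0.CubeData D cq) {α : ℝ} (hα1 : α ≤ 1) {μ : Fin (d + 1)}
    {δ₁ δ₂ δ₃ δ₄ c' cd cH : ℝ} (hδ₄ : 0 < δ₄) (h41 : δ₄ ≤ δ₁) (h42 : δ₄ ≤ δ₂) (h43 : δ₄ ≤ δ₃)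
    (hc' : 0 ≤ c') (hcd : 0 ≤ cd) (hcH : 0 ≤ cH)
    (h243 : ∀ b, roww δ₁ ((ℓ + 1) ^ fin D cq.1 cq.2) (cG D a c cq.1 (fin D cq.1 cq.2) cq.2 hP hc.hq) b ≤ c')
    (h243d : ∀ (i : Fin (d + 1)) (u ue : ↥(Box d ℓ (fin D cq.1 cq.2)
        (fun ν => (ℓ + 1) * cubeM' (MhP ℓ Mh cq.1 (fin D cq.1 cq.2)) (Pj ℓ k P cq.1) cq.2 ν))),
      ue.1 = u.1 + Pi.single i 1 →
      ∑ z, |(((ℓ + 1) ^ fin D cq.1 cq.2 : ℕ) : ℝ)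
            * (cG D a c cq.1 (fin D cq.1 cq.2) cq.2 hP hc.hq ue z - cG D a c cq.1 (fin D cq.1 cq.2) cq.2 hP hc.hq u z)|
          * Real.exp (δ₂ * supNorm (u.1 - z.1) / (((ℓ + 1) ^ fin D cq.1 cq.2 : ℕ) : ℝ)) ≤ cd)
    (hH : ∀ (u ue u' ue' : ↥(Box d ℓ (fin D cq.1 cq.2)
        (fun ν => (ℓ + 1) * cubeM' (MhP ℓ Mh cq.1 (fin D cq.1 cq.2)) (Pj ℓ k P cq.1) cq.2 ν))),
      ue.1 = u.1 + Pi.single μ 1 → ue'.1 = u'.1 + Pi.single μ 1 → u'.1 ≠ u.1 →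
      ∑ z, |((((ℓ + 1) ^ fin D cq.1 cq.2 : ℕ) : ℝ) / supNorm (u'.1 - u.1)) ^ α
            * ((((ℓ + 1) ^ fin D cq.1 cq.2 : ℕ) : ℝ)
              * ((cG D a c cq.1 (fin D cq.1 cq.2) cq.2 hP hc.hq ue' z - cG D a c cq.1 (fin D cq.1 cq.2) cq.2 hP hc.hq u' z)
                - (cG D a c cq.1 (fin D cq.1 cq.2) cq.2 hP hc.hq ue z - cG D a c cq.1 (fin D cq.1 cq.2) cq.2 hP hc.hq u z)))|
          * Real.exp (δ₃ * min (supNorm (u.1 - z.1)) (supNorm (u'.1 - z.1)) / (((ℓ + 1) ^ fin D cq.1 cq.2 : ℕ) : ℝ))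
        ≤ cH)
    (y' : ↥(bset D)) (lam : ↥(boxDom (N0 ℓ Mh k P)) → ℝ) (B : ℝ) (hlam : BlockSupp (g := geom D) (blkOf D) lam y' B)
    (x x' : ↥(boxDom (N0 ℓ Mh k P))) (hne : x'.1 ≠ x.1) (hblk : blkOf D x' = blkOf D x)
    (hxe : x.1 + Pi.single μ 1 ∈ boxDom (N0 ℓ Mh k P)) (hxe' : x'.1 + Pi.single μ 1 ∈ boxDom (N0 ℓ Mh k P))
    (hnear : supNorm (x'.1 - x.1) + 1 ≤ 2 * (((ℓ + 1) ^ fin D cq.1 cq.2 : ℕ) : ℝ))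
    (hu : uX (ℓ := ℓ) (Mh := Mh) (k := k) (P := P) cq x ≠ 0
      ∨ uX (ℓ := ℓ) (Mh := Mh) (k := k) (P := P) cq ⟨x.1 + Pi.single μ 1, hxe⟩ ≠ 0
      ∨ uX (ℓ := ℓ) (Mh := Mh) (k := k) (P := P) cq x' ≠ 0
      ∨ uX (ℓ := ℓ) (Mh := Mh) (k := k) (P := P) cq ⟨x'.1 + Pi.single μ 1, hxe'⟩ ≠ 0) :
    (supNorm (x'.1 - x.1)) ^ (-α)
        * |((aX D a c hP cq hc *ᵥ lam) ⟨x'.1 + Pi.single μ 1, hxe'⟩ - (aX D a c hP cq hc *ᵥ lam) x')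
            - ((aX D a c hP cq hc *ᵥ lam) ⟨x.1 + Pi.single μ 1, hxe⟩ - (aX D a c hP cq hc *ᵥ lam) x)|
      ≤ (((ℓ : ℝ) + 1) ^ D.lev x.1) ^ (1 - α)
        * (((D2 hprof + d * D1 hprof ^ 2) * (c' * (Real.exp δ₁ * Real.exp δ₁))
            + (d + 1) * D1 hprof * (cd * (Real.exp δ₂ * Real.exp δ₂))
            + (d + 1) * ((d + 1) * D1 hprof) * (cd * (Real.exp δ₂ * Real.exp δ₂ * (Real.exp δ₂ * Real.exp δ₂)))
            + cH * (Real.exp δ₃ * Real.exp δ₃))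
          * Real.exp (-(δ₄ / (d + 1) * (geom D).dist (blkOf D x) y')) * B) := by
  obtain ⟨-, hij, hji, -, -⟩ := fin_data hc
  have hjk := hc.hj.2
  have hMh1 : 1 ≤ Mh := le_trans (by norm_num) hMh
  have hMh2 : 2 ≤ Mh := le_trans (by norm_num) hMh
  have hL1 : (1 : ℝ) ≤ (ℓ : ℝ) + 1 := by linarith [(Nat.cast_nonneg ℓ : (0 : ℝ) ≤ ℓ)]
  have hD1 := D1_nonneg contDiff_hprof hasCompactSupport_hprof
  have hD2 := D2_nonneg contDiff_hprof hasCompactSupport_hprof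
  have hδ₁0 : 0 ≤ δ₁ := hδ₄.le.trans h41
  have hδ₂0 : 0 ≤ δ₂ := hδ₄.le.trans h42
  have hδ₃0 : 0 ≤ δ₃ := hδ₄.le.trans h43
  have hlamB : ∀ w, |lam w| ≤ B := fun w => BlockSupp.abs_le hlam w
  have hB0 : 0 ≤ B := hlam.nonneg
  obtain ⟨dist0, hdist0⟩ : ∃ t : ℝ, t = (((bond D).dist (blkOf D x) y' : ℕ) : ℝ) := ⟨_, rfl⟩
  have hgeom : (geom D).dist (blkOf D x) y' = dist0 := by rw [hdist0]; rfl
  have hgeom' : (geom D).dist (blkOf D x') y' = dist0 := by rw [hblk, hgeom]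
  have hdist0nn : 0 ≤ dist0 := by rw [hdist0]; positivity
  rw [hgeom]
  -- the four points
  obtain ⟨xe, hxedef⟩ : ∃ t : ↥(boxDom (N0 ℓ Mh k P)), t = ⟨x.1 + Pi.single μ 1, hxe⟩ := ⟨_, rfl⟩
  obtain ⟨xe', hxe'def⟩ : ∃ t : ↥(boxDom (N0 ℓ Mh k P)), t = ⟨x'.1 + Pi.single μ 1, hxe'⟩ := ⟨_, rfl⟩
  rw [← hxedef, ← hxe'def] at hu ⊢
  have hxe1 : xe.1 = x.1 + Pi.single μ 1 := by rw [hxedef]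
  have hxe'1 : xe'.1 = x'.1 + Pi.single μ 1 := by rw [hxe'def]
  -- the mesh `n = L^{i_□}`, the Hölder distance `s`, the level factor
  obtain ⟨nn, hnn⟩ : ∃ t : ℝ, t = (((ℓ + 1) ^ fin D cq.1 cq.2 : ℕ) : ℝ) := ⟨_, rfl⟩
  have hncast : nn = ((ℓ : ℝ) + 1) ^ fin D cq.1 cq.2 := by rw [hnn]; push_cast; ring
  have hn1 : (1 : ℝ) ≤ nn := by rw [hnn]; exact_mod_cast Nat.one_le_pow _ _ (by omega)
  have hn0 : (0 : ℝ) < nn := lt_of_lt_of_le one_pos hn1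
  rw [← hnn] at hnear h243d hH
  obtain ⟨s, hs⟩ : ∃ t : ℝ, t = supNorm (x'.1 - x.1) := ⟨_, rfl⟩
  have hs1 : 1 ≤ s := by rw [hs]; exact B4StripSumsHolder.one_le_supNorm (sub_ne_zero.2 hne)
  have hs0 : 0 < s := lt_of_lt_of_le one_pos hs1
  rw [← hs] at hnear ⊢
  have hW0 : 0 ≤ s ^ (-α) := Real.rpow_nonneg hs0.le _
  obtain ⟨LJ, hLJ⟩ : ∃ t : ℝ, t = ((ℓ : ℝ) + 1) ^ D.lev x.1 := ⟨_, rfl⟩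
  rw [← hLJ]
  have hLJ0 : 0 < LJ := by rw [hLJ]; positivity
  -- `s ≤ L^j − 1` (one block), hence `s^{−α}·s ≤ (L^j)^{1−α}`
  have hsLJ : s ≤ LJ := by
    have h := supNorm_le_of_blkOf_eq (D := D) hblk
    have e : (((ℓ + 1) ^ D.lev x.1 : ℕ) : ℝ) = LJ := by rw [hLJ]; push_cast; ring
    rw [← hs, e] at h
    exact h.trans (sub_le_self _ zero_le_one)
  have hWs : s ^ (-α) * s ≤ LJ ^ (1 - α) := rpow_neg_mul_self_le hs0 hsLJ hα1
  have hLJα0 : 0 ≤ LJ ^ (1 - α) := Real.rpow_nonneg hLJ0.le _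
  -- every point of the quadruple lies in the cube image: one of them carries `h_□`, the others are within `2n`
  have himg : ∀ w : ↥(boxDom (N0 ℓ Mh k P)), (w = x ∨ w = xe ∨ w = x' ∨ w = xe') →
      ∃ b, embC D hP cq hc b = (castP (ℓ := ℓ) (Mh := Mh) (P := P) hij hjk).symm w := by
    intro w hw
    have hwd : ∀ z : ↥(boxDom (N0 ℓ Mh k P)), (z = x ∨ z = xe ∨ z = x' ∨ z = xe') →
        supNorm (w.1 - z.1) ≤ 2 * nn := by
      intro z hz
      have h := quad_dist_le x.1 xe.1 x'.1 xe'.1 hxe1 hxe'1 w.1 z.1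
        (by rcases hw with rfl | rfl | rfl | rfl <;> simp) (by rcases hz with rfl | rfl | rfl | rfl <;> simp)
      rw [← hs] at h
      exact h.trans hnear
    rcases hu with h | h | h | h
    · exact img_of_near hℓ hP hMh cq hc h (by have h' := hwd x (Or.inl rfl); rwa [hnn] at h')
    · exact img_of_near hℓ hP hMh cq hc h (by have h' := hwd xe (Or.inr (Or.inl rfl)); rwa [hnn] at h')
    · exact img_of_near hℓ hP hMh cq hc h
        (by have h' := hwd x' (Or.inr (Or.inr (Or.inl rfl))); rwa [hnn] at h')
    · exact img_of_near hℓ hP hMh cq hc h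
        (by have h' := hwd xe' (Or.inr (Or.inr (Or.inr rfl))); rwa [hnn] at h')
  obtain ⟨b, hb⟩ := himg x (Or.inl rfl)
  obtain ⟨be, hbe⟩ := himg xe (Or.inr (Or.inl rfl))
  obtain ⟨b', hb'⟩ := himg x' (Or.inr (Or.inr (Or.inl rfl)))
  obtain ⟨be', hbe'⟩ := himg xe' (Or.inr (Or.inr (Or.inr rfl)))
  have hzval : ∀ w : ↥(boxDom (N0 ℓ Mh k P)), ((castP (ℓ := ℓ) (Mh := Mh) (P := P) hij hjk).symm w).1 = w.1 :=
    fun w => by unfold castP; exact boxCast_symm_apply_val _ _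
  have hbx : (embC D hP cq hc b).1 = x.1 := by rw [hb, hzval]
  have hbex : (embC D hP cq hc be).1 = xe.1 := by rw [hbe, hzval]
  have hb'x : (embC D hP cq hc b').1 = x'.1 := by rw [hb', hzval]
  have hbe'x : (embC D hP cq hc be').1 = xe'.1 := by rw [hbe', hzval]
  have hsubE : ∀ u v, (embC D hP cq hc u).1 - (embC D hP cq hc v).1 = u.1 - v.1 := fun u v => by
    unfold embC; exact emb_sub_emb _ hc.hq u v
  have hbeb : be.1 = b.1 + Pi.single μ 1 := by
    have h1 := hsubE be b
    rw [hbex, hbx, hxe1, add_sub_cancel_left, eq_comm, sub_eq_iff_eq_add'] at h1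
    exact h1
  have hbe'b' : be'.1 = b'.1 + Pi.single μ 1 := by
    have h1 := hsubE be' b'
    rw [hbe'x, hb'x, hxe'1, add_sub_cancel_left, eq_comm, sub_eq_iff_eq_add'] at h1
    exact h1
  have hb'b : b'.1 - b.1 = x'.1 - x.1 := by rw [← hsubE b' b, hb'x, hbx]
  have hsb : supNorm (b'.1 - b.1) = s := by rw [hb'b, hs]
  have hneb : b'.1 ≠ b.1 := fun h => hne (by
    have := hb'b; rw [h, sub_self] at this; exact (sub_eq_zero.1 this.symm))
  have hbe'be : supNorm (be'.1 - be.1) = s := by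
    rw [hbe'b', hbeb, show b'.1 + Pi.single μ 1 - (b.1 + Pi.single μ 1) = b'.1 - b.1 by abel, hsb]
  -- the points of the quadruple lie in the cube: the level window `i_□ ≤ j ≤ i_□ + 1`
  have hxin : InCube ℓ Mh k P cq.1 cq.2 x.1 := by
    rw [← hzval x]; exact (inCube_iff_exists_emb (Mh := Mh) hP hij hc.hq _).2 ⟨b, hb⟩
  have hx'in : InCube ℓ Mh k P cq.1 cq.2 x'.1 := by
    rw [← hzval x']; exact (inCube_iff_exists_emb (Mh := Mh) hP hij hc.hq _).2 ⟨b', hb'⟩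
  have hlevwin := lev_window_of_inCube hℓ hR hP hMh2 hc x.2 hxin
  have hnLJ : nn ≤ LJ := by rw [hncast, hLJ]; exact pow_le_pow_right₀ hL1 hlevwin.1
  have hnα : nn ^ (1 - α) ≤ LJ ^ (1 - α) := rpow_one_sub_le hn0.le hnLJ hα1
  -- the cube vector `U = res(v_□λ ∘ cast)`, its bound and its support distances
  obtain ⟨Dd, hDd⟩ : ∃ t : ℝ, t = nn * (dist0 / (d + 1) - 1) := ⟨_, rfl⟩
  have hF : ∀ z, |(res (embC D hP cq hc) *ᵥ ((Matrix.diagonal (vX D cq) *ᵥ lam) ∘ castP (fin_data hc).2.1 hc.hj.2)) z|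
      ≤ B := by
    intro z
    rw [res_mulVec, Function.comp_apply, Matrix.mulVec_diagonal, abs_mul]
    calc |vX D cq _| * |lam _| ≤ 1 * B := mul_le_mul (abs_vFun_le_one _ _ _) (hlamB _) (abs_nonneg _) zero_le_one
      _ = B := one_mul _
  have hDgen : ∀ (w : ↥(boxDom (N0 ℓ Mh k P))) (bw : ↥(Box d ℓ (fin D cq.1 cq.2)
      (fun ν => (ℓ + 1) * cubeM' (MhP ℓ Mh cq.1 (fin D cq.1 cq.2)) (Pj ℓ k P cq.1) cq.2 ν))),
      (embC D hP cq hc bw).1 = w.1 → InCube ℓ Mh k P cq.1 cq.2 w.1 → (geom D).dist (blkOf D w) y' = dist0 →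
      ∀ z, (res (embC D hP cq hc) *ᵥ ((Matrix.diagonal (vX D cq) *ᵥ lam) ∘ castP (fin_data hc).2.1 hc.hj.2)) z ≠ 0 →
        Dd ≤ supNorm (bw.1 - z.1) := by
    intro w bw hbw hwin hwd z hz
    rw [res_mulVec, Function.comp_apply, Matrix.mulVec_diagonal] at hz
    set x'' : ↥(boxDom (N0 ℓ Mh k P)) := castP (fin_data hc).2.1 hc.hj.2 (embC D hP cq hc z) with hx''
    have hμx : lam x'' ≠ 0 := fun h0 => hz (by rw [h0, mul_zero])
    have hx''val : x''.1 = (embC D hP cq hc z).1 := by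
      rw [hx'']; unfold castP; exact boxCast_apply_val _ _
    have hx''in : InCube ℓ Mh k P cq.1 cq.2 x''.1 := by
      rw [hx''val]
      exact (inCube_iff_exists_emb (Mh := Mh) hP hij hc.hq _).2 ⟨z, rfl⟩
    have hblk'' : blkOf D x'' = y' := by
      by_contra hne'
      exact hμx (hlam.off x'' hne')
    have h := Dd_le_supNorm hℓ hR hP hMh2 hc w x'' hwin hx''in y' hblk''
    have hsub : w.1 - x''.1 = bw.1 - z.1 := by rw [hx''val, ← hbw]; exact hsubE bw z
    rw [hsub] at h
    have hd' : (((bond D).dist (blkOf D w) y' : ℕ) : ℝ) = dist0 := hwd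
    rw [hd', ← hnn, ← hDd] at h
    exact h
  have hD_b := hDgen x b hbx hxin hgeom
  have hD_b' := hDgen x' b' hb'x hx'in hgeom'
  have hD_be : ∀ z, (res (embC D hP cq hc) *ᵥ ((Matrix.diagonal (vX D cq) *ᵥ lam) ∘ castP (fin_data hc).2.1 hc.hj.2)) z
      ≠ 0 → Dd - 1 ≤ supNorm (be.1 - z.1) := by
    intro z hz
    have h1 := hD_b z hz
    have h2 := supNorm_sub_le_nbr (x' := z.1) hbeb
    linarith only [h1, h2]
  have hD_be' : ∀ z, (res (embC D hP cq hc) *ᵥ ((Matrix.diagonal (vX D cq) *ᵥ lam) ∘ castP (fin_data hc).2.1 hc.hj.2)) z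
      ≠ 0 → Dd - 1 ≤ supNorm (be'.1 - z.1) := by
    intro z hz
    have h1 := hD_b' z hz
    have h2 := supNorm_sub_le_nbr (x' := z.1) hbe'b'
    linarith only [h1, h2]
  have hDmin : ∀ z, (res (embC D hP cq hc) *ᵥ ((Matrix.diagonal (vX D cq) *ᵥ lam) ∘ castP (fin_data hc).2.1 hc.hj.2)) z
      ≠ 0 → Dd ≤ min (supNorm (b.1 - z.1)) (supNorm (b'.1 - z.1)) := fun z hz =>
    le_min (hD_b z hz) (hD_b' z hz)
  -- the exponent bookkeeping at the common rate `δ₄`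
  obtain ⟨E4, hE4⟩ : ∃ t : ℝ, t = Real.exp (-(δ₄ / (d + 1) * dist0)) := ⟨_, rfl⟩
  rw [← hE4]
  have hE1 : Real.exp (-(δ₁ * (Dd - 1) / nn)) ≤ Real.exp δ₁ * Real.exp δ₁ * E4 := by
    rw [hDd, hE4]; exact exp_shift_Dd_le hδ₁0 h41 hn1 hdist0nn d
  have hE2 : Real.exp (-(δ₂ * Dd / nn)) ≤ Real.exp δ₂ * Real.exp δ₂ * E4 := by
    rw [hDd, hE4]; exact exp_Dd_le hδ₂0 h42 hn1 hdist0nn d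
  have hE2' : Real.exp (-(δ₂ * (Dd - 1) / nn)) ≤ Real.exp δ₂ * Real.exp δ₂ * E4 := by
    rw [hDd, hE4]; exact exp_shift_Dd_le hδ₂0 h42 hn1 hdist0nn d
  have hE3 : Real.exp (-(δ₃ * Dd / nn)) ≤ Real.exp δ₃ * Real.exp δ₃ * E4 := by
    rw [hDd, hE4]; exact exp_Dd_le hδ₃0 h43 hn1 hdist0nn d
  -- the four cube values `g_i = (G′(□)U)(b_i)`
  obtain ⟨U, hU⟩ : ∃ t : ↥(Box d ℓ (fin D cq.1 cq.2)
      (fun ν => (ℓ + 1) * cubeM' (MhP ℓ Mh cq.1 (fin D cq.1 cq.2)) (Pj ℓ k P cq.1) cq.2 ν)) → ℝ,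
      t = res (embC D hP cq hc) *ᵥ ((Matrix.diagonal (vX D cq) *ᵥ lam) ∘ castP (fin_data hc).2.1 hc.hj.2) :=
    ⟨_, rfl⟩
  rw [← hU] at hF hD_b hD_b' hD_be hD_be' hDmin
  obtain ⟨Gc, hGc⟩ : ∃ T, T = cG D a c cq.1 (fin D cq.1 cq.2) cq.2 hP hc.hq := ⟨_, rfl⟩
  rw [← hGc] at h243 h243d hH
  -- (K1) the value at `b_e′`: (2.43)₁
  have hg4 : |(Gc *ᵥ U) be'| ≤ c' * (Real.exp δ₁ * Real.exp δ₁ * E4) * B := by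
    have h := mulVec_le_of_roww hδ₁0 ((ℓ + 1) ^ fin D cq.1 cq.2) Gc be' (h243 be') U hF hD_be'
    rw [← hnn] at h
    refine h.trans ?_
    exact mul_le_mul_of_nonneg_right (mul_le_mul_of_nonneg_left hE1 hc') hB0
  -- (K2) the differenced value at `b′`: (2.43)₂
  have hg43 : |nn * ((Gc *ᵥ U) be' - (Gc *ᵥ U) b')| ≤ cd * (Real.exp δ₂ * Real.exp δ₂ * E4) * B := by
    have hsum : nn * ((Gc *ᵥ U) be' - (Gc *ᵥ U) b') = ∑ z, nn * (Gc be' z - Gc b' z) * U z := by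
      simp only [Matrix.mulVec, dotProduct]
      rw [← Finset.sum_sub_distrib, Finset.mul_sum]
      exact Finset.sum_congr rfl fun z _ => by ring
    rw [hsum]
    have h := sum_mul_le_of_wrow hn0 hB0 (fun z => nn * (Gc be' z - Gc b' z)) U (fun z => supNorm (b'.1 - z.1))
      (h243d μ b' be' hbe'b') hF hD_b' hδ₂0
    refine h.trans ?_
    exact mul_le_mul_of_nonneg_right (mul_le_mul_of_nonneg_left hE2 hcd) hB0
  -- (K3) the long difference `b_e′` versus `b_e`: telescoped (2.43)₂
  have hg42 : |(Gc *ᵥ U) be' - (Gc *ᵥ U) be|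
      ≤ (d + 1) * s * (Real.exp δ₂ * Real.exp δ₂ * cd / nn) * (Real.exp δ₂ * Real.exp δ₂ * E4) * B := by
    have hsum : (Gc *ᵥ U) be' - (Gc *ᵥ U) be = ∑ z, (Gc be' z - Gc be z) * U z := by
      simp only [Matrix.mulVec, dotProduct]
      rw [← Finset.sum_sub_distrib]
      exact Finset.sum_congr rfl fun z _ => by ring
    rw [hsum]
    have hn1' : 1 ≤ (ℓ + 1) ^ fin D cq.1 cq.2 := Nat.one_le_pow _ _ (by omega)
    have hlong := wsum_longDiff_le hδ₂0 hn1' Gc hcd (fun i u ue hue => by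
      unfold wsum; rw [← hnn]; exact h243d i u ue hue) be be' (s := 2 * nn) (by rw [hbe'be]; linarith only [hnear])
    unfold wsum at hlong
    rw [← hnn, hbe'be] at hlong
    have h := sum_mul_le_of_wrow hn0 hB0 (fun z => Gc be' z - Gc be z) U (fun z => supNorm (be.1 - z.1)) hlong hF
      hD_be hδ₂0
    refine h.trans ?_
    have he : Real.exp (δ₂ * (2 * nn) / nn) = Real.exp δ₂ * Real.exp δ₂ := by
      rw [← Real.exp_add]; congr 1; field_simp; ring
    rw [he]
    have h0 : 0 ≤ (d + 1) * s * (Real.exp δ₂ * Real.exp δ₂ * cd / nn) := by positivity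
    exact mul_le_mul_of_nonneg_right (mul_le_mul_of_nonneg_left hE2' h0) hB0
  -- (K4) the Hölder-weighted mixed difference: the cube Hölder clause
  have hgdd : |∑ z, ((nn / s) ^ α * (nn * ((Gc be' z - Gc b' z) - (Gc be z - Gc b z)))) * U z|
      ≤ cH * (Real.exp δ₃ * Real.exp δ₃ * E4) * B := by
    have hrow := hH b be b' be' hbeb hbe'b' hneb
    rw [hsb] at hrow
    have h := sum_mul_le_of_wrow hn0 hB0 (fun z => (nn / s) ^ α * (nn * ((Gc be' z - Gc b' z) - (Gc be z - Gc b z))))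
      U (fun z => min (supNorm (b.1 - z.1)) (supNorm (b'.1 - z.1))) hrow hF hDmin hδ₃0
    refine h.trans ?_
    exact mul_le_mul_of_nonneg_right (mul_le_mul_of_nonneg_left hE3 hcH) hB0
  -- the cut-off coefficients
  have hNj1 : 1 ≤ (ℓ + 1) ^ cq.1 := Nat.one_le_pow _ _ (by omega)
  have hM1 : 1 ≤ (ℓ + 1) * Mh := Nat.one_le_iff_ne_zero.2 (Nat.mul_ne_zero_iff.2 ⟨by omega, by omega⟩)
  have hNM1 : 1 ≤ (ℓ + 1) ^ cq.1 * ((ℓ + 1) * Mh) := Nat.one_le_iff_ne_zero.2 (by positivity)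
  obtain ⟨Nj, hNj⟩ : ∃ t : ℝ, t = (((ℓ + 1) ^ cq.1 : ℕ) : ℝ) := ⟨_, rfl⟩
  obtain ⟨Mc, hMc⟩ : ∃ t : ℝ, t = (((ℓ + 1) * Mh : ℕ) : ℝ) := ⟨_, rfl⟩
  have hNj1r : 1 ≤ Nj := by rw [hNj]; exact_mod_cast hNj1
  have hMc1 : 1 ≤ Mc := by rw [hMc]; exact_mod_cast hM1
  have hNj0 : 0 < Nj := lt_of_lt_of_le one_pos hNj1r
  have hMc0 : 0 < Mc := lt_of_lt_of_le one_pos hMc1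
  have hnNj : nn ≤ Nj := by
    rw [hnn, hNj]; exact_mod_cast Nat.pow_le_pow_right (by omega) hij
  have hNMcast : (((ℓ + 1) ^ cq.1 * ((ℓ + 1) * Mh) : ℕ) : ℝ) = Nj * Mc := by rw [hNj, hMc]; push_cast; ring
  -- `|dd h_□| ≤ (D₂ + dD₁²)s/(N_jM)²`
  have hddu : |(uX (ℓ := ℓ) (Mh := Mh) (k := k) (P := P) cq xe' - uX (ℓ := ℓ) (Mh := Mh) (k := k) (P := P) cq x')
        - (uX (ℓ := ℓ) (Mh := Mh) (k := k) (P := P) cq xe - uX (ℓ := ℓ) (Mh := Mh) (k := k) (P := P) cq x)|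
      ≤ (D2 hprof + d * D1 hprof ^ 2) * s / (Nj * Mc) ^ 2 := by
    have h := abs_hq_dd_le (d := d) hNM1 cq.2 μ x.1 x'.1
    rw [hNMcast, ← hs, ← hxe1, ← hxe'1] at h
    exact h
  -- `|h_□(x′) − h_□(x)| ≤ (d+1)D₁·s/(M·N_j)`
  have hdu31 : |uX (ℓ := ℓ) (Mh := Mh) (k := k) (P := P) cq x' - uX (ℓ := ℓ) (Mh := Mh) (k := k) (P := P) cq x|
      ≤ (d + 1) * D1 hprof / Mc * s / Nj := by
    have h := abs_hq_sub_le (d := d) hNj1 hM1 cq.2 x.1 x'.1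
    rw [← hNj, ← hMc, ← hs] at h
    exact h
  -- `|h_□(x+e_μ) − h_□(x)| ≤ (d+1)D₁/(M·N_j)`
  have hdu21 : |uX (ℓ := ℓ) (Mh := Mh) (k := k) (P := P) cq xe - uX (ℓ := ℓ) (Mh := Mh) (k := k) (P := P) cq x|
      ≤ (d + 1) * D1 hprof / Mc / Nj := by
    have h := abs_hq_sub_le (d := d) hNj1 hM1 cq.2 x.1 xe.1
    rw [← hNj, ← hMc] at h
    have hs1' : supNorm (xe.1 - x.1) ≤ 1 := by rw [hxe1, add_sub_cancel_left]; exact supNorm_single_le μ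
    refine h.trans ?_
    have h0 : 0 ≤ (d + 1) * D1 hprof / Mc := by positivity
    calc (d + 1) * D1 hprof / Mc * supNorm (xe.1 - x.1) / Nj ≤ (d + 1) * D1 hprof / Mc * 1 / Nj := by gcongr
      _ = (d + 1) * D1 hprof / Mc / Nj := by rw [mul_one]
  have hu1 : |uX (ℓ := ℓ) (Mh := Mh) (k := k) (P := P) cq x| ≤ 1 := abs_hq_le_one _ _ _ _
  -- rewriting the four values of `h_□G′(□)v_□λ`
  rw [aX_mulVec_apply, aX_mulVec_apply, aX_mulVec_apply, aX_mulVec_apply, gX_row_img hP cq hc _ hbe',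
    gX_row_img hP cq hc _ hb', gX_row_img hP cq hc _ hbe, gX_row_img hP cq hc _ hb, ← hU, ← hGc]
  have hn2eq : ((((ℓ : ℝ) + 1)) ^ fin D cq.1 cq.2) ^ 2 = nn * nn := by rw [hncast]; ring
  rw [hn2eq]
  obtain ⟨g₁, hg₁⟩ : ∃ t : ℝ, t = (Gc *ᵥ U) b := ⟨_, rfl⟩
  obtain ⟨g₂, hg₂⟩ : ∃ t : ℝ, t = (Gc *ᵥ U) be := ⟨_, rfl⟩
  obtain ⟨g₃, hg₃⟩ : ∃ t : ℝ, t = (Gc *ᵥ U) b' := ⟨_, rfl⟩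
  obtain ⟨g₄, hg₄'⟩ : ∃ t : ℝ, t = (Gc *ᵥ U) be' := ⟨_, rfl⟩
  rw [← hg₁, ← hg₂, ← hg₃, ← hg₄']
  rw [← hg₄'] at hg4
  rw [← hg₄', ← hg₃] at hg43
  rw [← hg₄', ← hg₂] at hg42
  -- `ddG` as a sum against `U`
  have hddsum : s ^ (-α) * ((nn * nn * g₄ - nn * nn * g₃) - (nn * nn * g₂ - nn * nn * g₁))
      = nn ^ (1 - α) * ∑ z, ((nn / s) ^ α * (nn * ((Gc be' z - Gc b' z) - (Gc be z - Gc b z)))) * U z := by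
    have e1 : s ^ (-α) * ((nn * nn * g₄ - nn * nn * g₃) - (nn * nn * g₂ - nn * nn * g₁))
        = (s ^ (-α) * (nn * nn)) * ((g₄ - g₃) - (g₂ - g₁)) := by ring
    rw [e1, rpow_weight_identity hn0 hs0, mul_assoc]
    congr 1
    rw [hg₁, hg₂, hg₃, hg₄']
    simp only [Matrix.mulVec, dotProduct]
    rw [← Finset.sum_sub_distrib, ← Finset.sum_sub_distrib, ← Finset.sum_sub_distrib, Finset.mul_sum]
    exact Finset.sum_congr rfl fun z _ => by ring
  obtain ⟨u₁, hu₁⟩ : ∃ t : ℝ, t = uX (ℓ := ℓ) (Mh := Mh) (k := k) (P := P) cq x := ⟨_, rfl⟩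
  obtain ⟨u₂, hu₂⟩ : ∃ t : ℝ, t = uX (ℓ := ℓ) (Mh := Mh) (k := k) (P := P) cq xe := ⟨_, rfl⟩
  obtain ⟨u₃, hu₃⟩ : ∃ t : ℝ, t = uX (ℓ := ℓ) (Mh := Mh) (k := k) (P := P) cq x' := ⟨_, rfl⟩
  obtain ⟨u₄, hu₄⟩ : ∃ t : ℝ, t = uX (ℓ := ℓ) (Mh := Mh) (k := k) (P := P) cq xe' := ⟨_, rfl⟩
  rw [← hu₁, ← hu₂, ← hu₃, ← hu₄] at hddu
  rw [← hu₁, ← hu₃] at hdu31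
  rw [← hu₁, ← hu₂] at hdu21
  rw [← hu₁] at hu1
  rw [← hu₁, ← hu₂, ← hu₃, ← hu₄]
  rw [← abs_of_nonneg hW0, ← abs_mul]
  -- the constants of the four terms
  obtain ⟨Q₁, hQ₁⟩ : ∃ t : ℝ, t = (D2 hprof + d * D1 hprof ^ 2) * (c' * (Real.exp δ₁ * Real.exp δ₁)) := ⟨_, rfl⟩
  obtain ⟨Q₂, hQ₂⟩ : ∃ t : ℝ, t = (d + 1) * D1 hprof * (cd * (Real.exp δ₂ * Real.exp δ₂)) := ⟨_, rfl⟩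
  obtain ⟨Q₃, hQ₃⟩ : ∃ t : ℝ, t = (d + 1) * ((d + 1) * D1 hprof)
      * (cd * (Real.exp δ₂ * Real.exp δ₂ * (Real.exp δ₂ * Real.exp δ₂))) := ⟨_, rfl⟩
  obtain ⟨Q₄, hQ₄⟩ : ∃ t : ℝ, t = cH * (Real.exp δ₃ * Real.exp δ₃) := ⟨_, rfl⟩
  rw [← hQ₁, ← hQ₂, ← hQ₃, ← hQ₄]
  have hsplit : LJ ^ (1 - α) * ((Q₁ + Q₂ + Q₃ + Q₄) * E4 * B)
      = LJ ^ (1 - α) * (Q₁ * E4 * B) + LJ ^ (1 - α) * (Q₂ * E4 * B) + LJ ^ (1 - α) * (Q₃ * E4 * B)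
        + LJ ^ (1 - α) * (Q₄ * E4 * B) := by ring
  rw [hsplit]
  have hE40 : 0 ≤ E4 := by rw [hE4]; exact (Real.exp_pos _).le
  have hnn0 : 0 ≤ nn * nn := by positivity
  refine four_term_abs_le ?_ ?_ ?_ ?_
  · -- TERM 1: `dd h_□ · G(x′+e_μ)`
    rw [abs_mul, abs_mul, abs_of_nonneg hW0, abs_mul, abs_of_nonneg hnn0]
    have hK0 : 0 ≤ D2 hprof + d * D1 hprof ^ 2 := by positivity
    have hn2le : nn * nn / (Nj * Mc) ^ 2 ≤ 1 := by
      rw [div_le_one (by positivity)]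
      have h1 : nn ≤ Nj * Mc :=
        calc nn ≤ Nj := hnNj
          _ = Nj * 1 := (mul_one _).symm
          _ ≤ Nj * Mc := mul_le_mul_of_nonneg_left hMc1 hNj0.le
      rw [sq]
      exact mul_le_mul h1 h1 hn0.le (by positivity)
    calc s ^ (-α) * |(u₄ - u₃) - (u₂ - u₁)| * (nn * nn * |g₄|)
        ≤ s ^ (-α) * ((D2 hprof + d * D1 hprof ^ 2) * s / (Nj * Mc) ^ 2)
            * (nn * nn * (c' * (Real.exp δ₁ * Real.exp δ₁ * E4) * B)) := by
          refine mul_le_mul (mul_le_mul_of_nonneg_left hddu hW0) (mul_le_mul_of_nonneg_left hg4 hnn0)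
            (by positivity) (by positivity)
      _ = (s ^ (-α) * s) * (nn * nn / (Nj * Mc) ^ 2) * (Q₁ * E4 * B) := by
          rw [hQ₁]; ring
      _ ≤ LJ ^ (1 - α) * 1 * (Q₁ * E4 * B) := by
          refine mul_le_mul (mul_le_mul hWs hn2le (by positivity) hLJα0) le_rfl (by rw [hQ₁]; positivity)
            (by positivity)
      _ = LJ ^ (1 - α) * (Q₁ * E4 * B) := by rw [mul_one]
  · -- TERM 2: `(h_□(x′) − h_□(x)) · ∂G(x′)`
    have e2 : s ^ (-α) * (u₃ - u₁) * (nn * nn * g₄ - nn * nn * g₃)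
        = (s ^ (-α) * (u₃ - u₁)) * nn * (nn * (g₄ - g₃)) := by ring
    rw [e2, abs_mul, abs_mul, abs_mul, abs_of_nonneg hW0, abs_of_nonneg hn0.le]
    calc s ^ (-α) * |u₃ - u₁| * nn * |nn * (g₄ - g₃)|
        ≤ s ^ (-α) * ((d + 1) * D1 hprof / Mc * s / Nj) * nn * (cd * (Real.exp δ₂ * Real.exp δ₂ * E4) * B) := by
          refine mul_le_mul (mul_le_mul_of_nonneg_right (mul_le_mul_of_nonneg_left hdu31 hW0) hn0.le) hg43
            (abs_nonneg _) (by positivity)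
      _ = (s ^ (-α) * s) * (nn / Nj) * (1 / Mc) * (Q₂ * E4 * B) := by
          rw [hQ₂]; ring
      _ ≤ LJ ^ (1 - α) * 1 * 1 * (Q₂ * E4 * B) := by
          refine mul_le_mul_of_nonneg_right ?_ (by rw [hQ₂]; positivity)
          refine mul_le_mul (mul_le_mul hWs ((div_le_one hNj0).2 hnNj) (by positivity) hLJα0)
            ((div_le_one hMc0).2 hMc1) (by positivity) (by positivity)
      _ = LJ ^ (1 - α) * (Q₂ * E4 * B) := by rw [mul_one, mul_one]
  · -- TERM 3: `∂h_□(x) · (G(x′+e_μ) − G(x+e_μ))`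
    have e3 : (u₂ - u₁) * (s ^ (-α) * (nn * nn * g₄ - nn * nn * g₂))
        = (u₂ - u₁) * (s ^ (-α) * (nn * nn) * (g₄ - g₂)) := by ring
    rw [e3, abs_mul, abs_mul, abs_of_nonneg (mul_nonneg hW0 hnn0)]
    have h0 : 0 ≤ (d + 1) * s * (Real.exp δ₂ * Real.exp δ₂ * cd / nn) * (Real.exp δ₂ * Real.exp δ₂ * E4) * B := by
      positivity
    calc |u₂ - u₁| * (s ^ (-α) * (nn * nn) * |g₄ - g₂|)
        ≤ ((d + 1) * D1 hprof / Mc / Nj) * (s ^ (-α) * (nn * nn)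
            * ((d + 1) * s * (Real.exp δ₂ * Real.exp δ₂ * cd / nn) * (Real.exp δ₂ * Real.exp δ₂ * E4) * B)) := by
          refine mul_le_mul hdu21 (mul_le_mul_of_nonneg_left hg42 (mul_nonneg hW0 hnn0)) (by positivity)
            (by positivity)
      _ = (s ^ (-α) * s) * (nn / Nj) * (1 / Mc) * (Q₃ * E4 * B) := by
          rw [hQ₃]; field_simp
      _ ≤ LJ ^ (1 - α) * 1 * 1 * (Q₃ * E4 * B) := by
          refine mul_le_mul_of_nonneg_right ?_ (by rw [hQ₃]; positivity)
          refine mul_le_mul (mul_le_mul hWs ((div_le_one hNj0).2 hnNj) (by positivity) hLJα0)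
            ((div_le_one hMc0).2 hMc1) (by positivity) (by positivity)
      _ = LJ ^ (1 - α) * (Q₃ * E4 * B) := by rw [mul_one, mul_one]
  · -- TERM 4: `h_□(x) · ddG`
    rw [hddsum, abs_mul, abs_mul, abs_of_nonneg (Real.rpow_nonneg hn0.le _)]
    calc |u₁| * (nn ^ (1 - α) * |∑ z, ((nn / s) ^ α * (nn * ((Gc be' z - Gc b' z) - (Gc be z - Gc b z)))) * U z|)
        ≤ 1 * (LJ ^ (1 - α) * (cH * (Real.exp δ₃ * Real.exp δ₃ * E4) * B)) :=
          mul_le_mul hu1 (mul_le_mul hnα hgdd (abs_nonneg _) hLJα0) (by positivity) zero_le_one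
      _ = LJ ^ (1 - α) * (Q₄ * E4 * B) := by rw [hQ₄]; ring

end NearTerm

/-! ## §5 One cube term over any pair: near pairs by §4, far pairs by two single differences -/

section OneTerm

variable {ℓ Mh k R : ℕ} {P : Fin (d + 1) → ℕ} {D : Domains d ℓ Mh k P R} {a c : ℕ → ℝ}

/-- the value of a cube term vanishes where its cut-off does. [cite: Balaban1984PropagatorsII, (2.37) p.229, dictionary] -/
private theorem aX_apply_eq_zero (hP : ∀ μ, 1 ≤ P μ) (cq : ℕ × (Fin (d + 1) → ℤ)) (hc : CubeData D cq)
    (lam : ↥(boxDom (N0 ℓ Mh k P)) → ℝ) {z : ↥(boxDom (N0 ℓ Mh k P))}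
    (hz : uX (ℓ := ℓ) (Mh := Mh) (k := k) (P := P) cq z = 0) : (aX D a c hP cq hc *ᵥ lam) z = 0 := by
  rw [aX_mulVec_apply, hz, zero_mul]

/-- a site where a cube term's bond difference is non-trivial lies in the cube: its level is in the window
`[i_□, i_□ + 1]`. [cite: Balaban1984PropagatorsII, (2.2) p.224 with p.230; Balaban1983RegularityDecay, (2.6) p.576] -/
private theorem lev_window_of_uX_or (hℓ : 1 ≤ ℓ) (hR : 2 * (ℓ + 1) ≤ R) (hP : ∀ μ, 1 ≤ P μ) (hMh : 2 ≤ Mh)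
    (cq : ℕ × (Fin (d + 1) → ℤ)) (hc : CubeData D cq) {μ : Fin (d + 1)} (x : ↥(boxDom (N0 ℓ Mh k P)))
    (hxe : x.1 + Pi.single μ 1 ∈ boxDom (N0 ℓ Mh k P))
    (hu : uX (ℓ := ℓ) (Mh := Mh) (k := k) (P := P) cq x ≠ 0
      ∨ uX (ℓ := ℓ) (Mh := Mh) (k := k) (P := P) cq ⟨x.1 + Pi.single μ 1, hxe⟩ ≠ 0) :
    fin D cq.1 cq.2 ≤ D.lev x.1 ∧ D.lev x.1 ≤ fin D cq.1 cq.2 + 1 := by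
  obtain ⟨-, hij, hji, -, -⟩ := fin_data hc
  have hjk := hc.hj.2
  have hx_nb : x.1 ∈ nbrs (⟨x.1 + Pi.single μ 1, hxe⟩ : ↥(boxDom (N0 ℓ Mh k P))).1 :=
    mem_nbrs.2 ⟨μ, Or.inr (by rw [add_sub_cancel_right])⟩
  obtain ⟨y, hy⟩ : ∃ y, embC D hP cq hc y = (castP (ℓ := ℓ) (Mh := Mh) (P := P) hij hjk).symm x := by
    rcases hu with h | h
    · exact img_of_uX_ne_zero hℓ hP hMh cq hc h (Or.inr rfl)
    · exact img_of_uX_ne_zero hℓ hP hMh cq hc h (Or.inl hx_nb)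
  have hzval : ((castP (ℓ := ℓ) (Mh := Mh) (P := P) hij hjk).symm x).1 = x.1 := by
    unfold castP; exact boxCast_symm_apply_val _ _
  have hxin : InCube ℓ Mh k P cq.1 cq.2 x.1 := by
    rw [← hzval]; exact (inCube_iff_exists_emb (Mh := Mh) hP hij hc.hq _).2 ⟨y, hy⟩
  exact lev_window_of_inCube hℓ hR hP hMh hc x.2 hxin

/-- **ONE TERM OF THE HÖLDER-WEIGHTED MIXED DIFFERENCE OF `G′₀`**: there are `δ₄, Q > 0` (functions of `d`, `ℓ`, `α`,
the windows) such that for every member `□` of the cover, every pair `x ≠ x′` of one block `B^j(y)` with `x + e_μ`,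
`x′ + e_μ` in the box and every `λ` supported in the block `y′` with `|λ| ≤ B`:
`|x′−x|_∞^{−α}·|((h_□G′(□)v_□λ)(x′+e_μ) − (…)(x′)) − ((…)(x+e_μ) − (…)(x))| ≤ (L^{j})^{1−α}·Q·e^{−δ₄d(y,y′)/(d+1)}·B` —
near pairs (`|x′−x|_∞ + 1 ≤ 2L^{i_□}`) by the four-term product rule of §5 with the three cube inputs
(`B6Ineq243TwoLevelBoxL0.ineq243_twoLevel_roww/_deriv_wsum`, `B6Ineq243HolderTwoLevelBox.ineq243_twoLevel_holder_wsum2`),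
far pairs by two single bond differences (file 6, `aX_diff_le`) and `|x′−x|^{−α}L^{j} ≤ L·(L^{j})^{1−α}`
(`L^{j} ≤ L·L^{i_□} ≤ L|x′−x|`). [cite: Balaban1984PropagatorsII, (2.64)–(2.67) p.234 («(L^jη)² replaced by … (L^jη)^{1−α}»), (2.43) p.230; Balaban1983RegularityDecay, Theorem (1.9) p.573] -/
theorem aX_dd_le (d ℓ : ℕ) (hℓ : 1 ≤ ℓ) (aminus aplus a2minus a2plus : ℝ) (ha : 0 < aminus) (ha2 : 0 < a2minus)
    (α : ℝ) (hα0 : 0 ≤ α) (hα1 : α < 1) :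
    ∃ δ₄ Q : ℝ, 0 < δ₄ ∧ 0 < Q ∧ ∀ (k Mh R : ℕ), 3 ≤ Mh → 2 * (ℓ + 1) ≤ R →
      ∀ (P : Fin (d + 1) → ℕ) (hP : ∀ μ, 1 ≤ P μ) (D : Domains d ℓ Mh k P R) (a c : ℕ → ℝ),
        (∀ i, aminus ≤ a i ∧ a i ≤ aplus) → (∀ i, a2minus ≤ c i ∧ c i ≤ a2plus) →
        ∀ (μ : Fin (d + 1)) (y' : ↥(bset D)) (lam : ↥(boxDom (N0 ℓ Mh k P)) → ℝ) (B : ℝ),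
          BlockSupp (g := geom D) (blkOf D) lam y' B →
          ∀ (x x' : ↥(boxDom (N0 ℓ Mh k P))), x'.1 ≠ x.1 → blkOf D x' = blkOf D x →
          ∀ (hxe : x.1 + Pi.single μ 1 ∈ boxDom (N0 ℓ Mh k P)) (hxe' : x'.1 + Pi.single μ 1 ∈ boxDom (N0 ℓ Mh k P))
            (cq : ℕ × (Fin (d + 1) → ℤ)) (hc : CubeData D cq),
            (supNorm (x'.1 - x.1)) ^ (-α)
                * |((aX D a c hP cq hc *ᵥ lam) ⟨x'.1 + Pi.single μ 1, hxe'⟩ - (aX D a c hP cq hc *ᵥ lam) x')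
                    - ((aX D a c hP cq hc *ᵥ lam) ⟨x.1 + Pi.single μ 1, hxe⟩ - (aX D a c hP cq hc *ᵥ lam) x)|
              ≤ (((ℓ : ℝ) + 1) ^ D.lev x.1) ^ (1 - α)
                * (Q * Real.exp (-(δ₄ / (d + 1) * (geom D).dist (blkOf D x) y')) * B) := by
  obtain ⟨δ'', c', hδ'', hc', h243⟩ := ineq243_twoLevel_roww d ℓ hℓ aminus aplus 0 a2minus a2plus ha ha2
  obtain ⟨δd, cd, hδd, hcd, h243d⟩ := ineq243_twoLevel_deriv_wsum d ℓ hℓ aminus aplus 0 a2minus a2plus ha ha2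
  obtain ⟨δH, cH, hδH, hcH, hH⟩ := ineq243_twoLevel_holder_wsum2 d ℓ hℓ aminus aplus 0 a2minus a2plus ha ha2 α hα0 hα1
  obtain ⟨δ₃, Q₃, hδ₃, hQ₃, hfar⟩ := aX_diff_le d ℓ hℓ aminus aplus a2minus a2plus ha ha2
  have hD1 := D1_nonneg contDiff_hprof hasCompactSupport_hprof
  have hD2 := D2_nonneg contDiff_hprof hasCompactSupport_hprof
  obtain ⟨δ₄, hδ₄⟩ : ∃ t : ℝ, t = min (min δ'' δd) (min δH δ₃) := ⟨_, rfl⟩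
  have hδ₄pos : 0 < δ₄ := by rw [hδ₄]; exact lt_min (lt_min hδ'' hδd) (lt_min hδH hδ₃)
  have h41 : δ₄ ≤ δ'' := by rw [hδ₄]; exact (min_le_left _ _).trans (min_le_left _ _)
  have h42 : δ₄ ≤ δd := by rw [hδ₄]; exact (min_le_left _ _).trans (min_le_right _ _)
  have h43 : δ₄ ≤ δH := by rw [hδ₄]; exact (min_le_right _ _).trans (min_le_left _ _)
  have h44 : δ₄ ≤ δ₃ := by rw [hδ₄]; exact (min_le_right _ _).trans (min_le_right _ _)
  obtain ⟨Qn, hQn⟩ : ∃ t : ℝ, t = (D2 hprof + d * D1 hprof ^ 2) * (c' * (Real.exp δ'' * Real.exp δ''))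
      + (d + 1) * D1 hprof * (cd * (Real.exp δd * Real.exp δd))
      + (d + 1) * ((d + 1) * D1 hprof) * (cd * (Real.exp δd * Real.exp δd * (Real.exp δd * Real.exp δd)))
      + cH * (Real.exp δH * Real.exp δH) := ⟨_, rfl⟩
  have hQn0 : 0 ≤ Qn := by rw [hQn]; positivity
  refine ⟨δ₄, Qn + 2 * ((ℓ : ℝ) + 1) * Q₃ + 1, hδ₄pos, by positivity, ?_⟩
  intro k Mh R hMh hR P hP D a c haw hcw μ y' lam B hlam x x' hne hblk hxe hxe' cq hc
  obtain ⟨-, hij, hji, -, -⟩ := fin_data hc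
  have hMh1 : 1 ≤ Mh := le_trans (by norm_num) hMh
  have hMh2 : 2 ≤ Mh := le_trans (by norm_num) hMh
  have hL1 : (1 : ℝ) ≤ (ℓ : ℝ) + 1 := by linarith [(Nat.cast_nonneg ℓ : (0 : ℝ) ≤ ℓ)]
  have hB0 : 0 ≤ B := hlam.nonneg
  have hdnn : 0 ≤ (geom D).dist (blkOf D x) y' := (triangle_refl_nonneg D hMh1 hP).2.2 _ _
  obtain ⟨E4, hE4⟩ : ∃ t : ℝ, t = Real.exp (-(δ₄ / (d + 1) * (geom D).dist (blkOf D x) y')) := ⟨_, rfl⟩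
  rw [← hE4]
  have hE40 : 0 ≤ E4 := by rw [hE4]; exact (Real.exp_pos _).le
  obtain ⟨LJ, hLJ⟩ : ∃ t : ℝ, t = ((ℓ : ℝ) + 1) ^ D.lev x.1 := ⟨_, rfl⟩
  rw [← hLJ]
  have hLJ0 : 0 < LJ := by rw [hLJ]; positivity
  have hLJα0 : 0 ≤ LJ ^ (1 - α) := Real.rpow_nonneg hLJ0.le _
  have hRHS0 : 0 ≤ LJ ^ (1 - α) * ((Qn + 2 * ((ℓ : ℝ) + 1) * Q₃ + 1) * E4 * B) := by positivity
  have hs1 : 1 ≤ supNorm (x'.1 - x.1) := B4StripSumsHolder.one_le_supNorm (sub_ne_zero.2 hne)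
  have hs0 : 0 < supNorm (x'.1 - x.1) := lt_of_lt_of_le one_pos hs1
  have hW0 : 0 ≤ (supNorm (x'.1 - x.1)) ^ (-α) := Real.rpow_nonneg hs0.le _
  -- the trivial case: the cut-off vanishes at the four points
  by_cases h0 : uX (ℓ := ℓ) (Mh := Mh) (k := k) (P := P) cq x = 0
      ∧ uX (ℓ := ℓ) (Mh := Mh) (k := k) (P := P) cq ⟨x.1 + Pi.single μ 1, hxe⟩ = 0
      ∧ uX (ℓ := ℓ) (Mh := Mh) (k := k) (P := P) cq x' = 0
      ∧ uX (ℓ := ℓ) (Mh := Mh) (k := k) (P := P) cq ⟨x'.1 + Pi.single μ 1, hxe'⟩ = 0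
  · rw [aX_apply_eq_zero hP cq hc lam h0.1, aX_apply_eq_zero hP cq hc lam h0.2.1, aX_apply_eq_zero hP cq hc lam h0.2.2.1,
      aX_apply_eq_zero hP cq hc lam h0.2.2.2]
    simp only [sub_self, abs_zero, mul_zero]
    exact hRHS0
  have hu : uX (ℓ := ℓ) (Mh := Mh) (k := k) (P := P) cq x ≠ 0
      ∨ uX (ℓ := ℓ) (Mh := Mh) (k := k) (P := P) cq ⟨x.1 + Pi.single μ 1, hxe⟩ ≠ 0
      ∨ uX (ℓ := ℓ) (Mh := Mh) (k := k) (P := P) cq x' ≠ 0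
      ∨ uX (ℓ := ℓ) (Mh := Mh) (k := k) (P := P) cq ⟨x'.1 + Pi.single μ 1, hxe'⟩ ≠ 0 := by
    by_contra h'; push Not at h'; exact h0 ⟨h'.1, h'.2.1, h'.2.2.1, h'.2.2.2⟩
  -- the level window at `x` (the level of `x′` is that of `x`)
  have hlevx' : D.lev x'.1 = D.lev x.1 := congrArg (fun s : ↥(bset D) => s.1.1) hblk
  have hwin : fin D cq.1 cq.2 ≤ D.lev x.1 ∧ D.lev x.1 ≤ fin D cq.1 cq.2 + 1 := by
    rcases hu with h | h | h | h
    · exact lev_window_of_uX_or hℓ hR hP hMh2 cq hc x hxe (Or.inl h)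
    · exact lev_window_of_uX_or hℓ hR hP hMh2 cq hc x hxe (Or.inr h)
    · rw [← hlevx']; exact lev_window_of_uX_or hℓ hR hP hMh2 cq hc x' hxe' (Or.inl h)
    · rw [← hlevx']; exact lev_window_of_uX_or hℓ hR hP hMh2 cq hc x' hxe' (Or.inr h)
  have hn1 : (1 : ℝ) ≤ (((ℓ + 1) ^ fin D cq.1 cq.2 : ℕ) : ℝ) := by exact_mod_cast Nat.one_le_pow _ _ (by omega)
  have hn0 : (0 : ℝ) < (((ℓ + 1) ^ fin D cq.1 cq.2 : ℕ) : ℝ) := lt_of_lt_of_le one_pos hn1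
  by_cases hnear : supNorm (x'.1 - x.1) + 1 ≤ 2 * (((ℓ + 1) ^ fin D cq.1 cq.2 : ℕ) : ℝ)
  · -- NEAR PAIRS: §5 with the three cube inputs of the lineage
    have hcM' : ∀ ν, 1 ≤ cubeM' (MhP ℓ Mh cq.1 (fin D cq.1 cq.2)) (Pj ℓ k P cq.1) cq.2 ν := fun ν =>
      Nat.one_le_iff_ne_zero.2 (Nat.mul_ne_zero_iff.2
        ⟨by have := one_le_MhP (ℓ := ℓ) hMh1 cq.1 (fin D cq.1 cq.2); omega,
          by have := (one_le_cubeW (one_le_Pj hP cq.1) hc.hq ν).1; omega⟩)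
    have key := aX_dd_near_le (D := D) (a := a) (c := c) hℓ hMh hR hP cq hc hα1.le (μ := μ) hδ₄pos h41 h42 h43
      hc'.le hcd.le hcH.le
      (fun b => h243 (fin D cq.1 cq.2) (a (fin D cq.1 cq.2)) 0 (c (fin D cq.1 cq.2)) (haw _).1 (haw _).2
        le_rfl le_rfl (hcw _).1 (hcw _).2 _ hcM' _ b)
      (fun i u ue hue => h243d (fin D cq.1 cq.2) (a (fin D cq.1 cq.2)) 0 (c (fin D cq.1 cq.2)) (haw _).1
        (haw _).2 le_rfl le_rfl (hcw _).1 (hcw _).2 _ hcM' _ i u ue hue)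
      (fun u ue u' ue' hue hue' hne' => hH (fin D cq.1 cq.2) (a (fin D cq.1 cq.2)) 0 (c (fin D cq.1 cq.2))
        (haw _).1 (haw _).2 le_rfl le_rfl (hcw _).1 (hcw _).2 _ hcM' _ μ u ue u' ue' hue hue' hne')
      y' lam B hlam x x' hne hblk hxe hxe' hnear hu
    rw [← hQn, ← hE4, ← hLJ] at key
    refine key.trans (mul_le_mul_of_nonneg_left ?_ hLJα0)
    refine mul_le_mul_of_nonneg_right (mul_le_mul_of_nonneg_right ?_ hE40) hB0
    nlinarith [hQ₃.le, hL1]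
  · -- FAR PAIRS: two single bond differences
    have hns : (((ℓ + 1) ^ fin D cq.1 cq.2 : ℕ) : ℝ) ≤ supNorm (x'.1 - x.1) := by
      push Not at hnear; linarith
    have hΔ := hfar k Mh R hMh hR P hP D a c haw hcw μ y' lam B hlam x hxe cq hc
    have hΔ' := hfar k Mh R hMh hR P hP D a c haw hcw μ y' lam B hlam x' hxe' cq hc
    rw [hblk, hlevx'] at hΔ'
    rw [← hLJ] at hΔ hΔ'
    have he3 : Real.exp (-(δ₃ / (d + 1) * (geom D).dist (blkOf D x) y')) ≤ E4 := by
      rw [hE4]; exact exp_rate_mono h44 hdnn d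
    have hT : LJ ≤ ((ℓ : ℝ) + 1) * (((ℓ + 1) ^ fin D cq.1 cq.2 : ℕ) : ℝ) := by
      rw [hLJ]; push_cast
      rw [← pow_succ']
      exact pow_le_pow_right₀ hL1 hwin.2
    have hWL : (supNorm (x'.1 - x.1)) ^ (-α) * LJ ≤ ((ℓ : ℝ) + 1) * LJ ^ (1 - α) :=
      rpow_far_le hn0 hns hLJ0 hT hL1 hα0 hα1.le
    calc (supNorm (x'.1 - x.1)) ^ (-α)
          * |((aX D a c hP cq hc *ᵥ lam) ⟨x'.1 + Pi.single μ 1, hxe'⟩ - (aX D a c hP cq hc *ᵥ lam) x')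
              - ((aX D a c hP cq hc *ᵥ lam) ⟨x.1 + Pi.single μ 1, hxe⟩ - (aX D a c hP cq hc *ᵥ lam) x)|
        ≤ (supNorm (x'.1 - x.1)) ^ (-α)
            * (LJ * (Q₃ * Real.exp (-(δ₃ / (d + 1) * (geom D).dist (blkOf D x) y')) * B)
              + LJ * (Q₃ * Real.exp (-(δ₃ / (d + 1) * (geom D).dist (blkOf D x) y')) * B)) :=
          mul_le_mul_of_nonneg_left ((abs_sub _ _).trans (add_le_add hΔ' hΔ)) hW0
      _ = ((supNorm (x'.1 - x.1)) ^ (-α) * LJ)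
            * (2 * Q₃ * Real.exp (-(δ₃ / (d + 1) * (geom D).dist (blkOf D x) y')) * B) := by ring
      _ ≤ (((ℓ : ℝ) + 1) * LJ ^ (1 - α)) * (2 * Q₃ * E4 * B) := by
          refine mul_le_mul hWL ?_ (by positivity) (by positivity)
          exact mul_le_mul_of_nonneg_right (mul_le_mul_of_nonneg_left he3 (by positivity)) hB0
      _ = LJ ^ (1 - α) * ((2 * ((ℓ : ℝ) + 1) * Q₃) * E4 * B) := by ring
      _ ≤ LJ ^ (1 - α) * ((Qn + 2 * ((ℓ : ℝ) + 1) * Q₃ + 1) * E4 * B) := by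
          refine mul_le_mul_of_nonneg_left ?_ hLJα0
          refine mul_le_mul_of_nonneg_right (mul_le_mul_of_nonneg_right (by linarith) hE40) hB0

end OneTerm

end

end Literature.MathematicalPhysics.QuantumFieldTheory.Balaban1983to89.B6HolderTermMultiLevelBoxL0
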